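import Literature.NumberTheory.Automorphic.HermitianLatticeTreeApartment        -- (S7a): the apartment, translation iterates, torus fixing
import Literature.Combinatorics.SimpleGraph.TreeRetractionOntoSubtree         -- ★ p843004 (N2b): `TreeRetraction.exists_retraction`
import Literature.GroupTheory.OrbitQuotientTubeCount                          -- ★ p843003 (N2a): `natCard_quotient_tube`
import Literature.GroupTheory.OrbitQuotientTransitiveCount                    -- ★ p843347 (N2-axis): `natCard_quotient_orbitRel_comap_eq_one/_two`, `natCard_quotient_tube_axis_cancel`
import HarnessLib

/-!
# «Per period of the translation, fixed vertices = fixed edges» on the lattice tree of the hyperbolic plane: the combinatorial heart of the NON-ELLIPTIC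
# Euler–Poincaré relation (Kottwitz 1988, §2 Thm. 2, non-elliptic case; Serre 1980, I.6.4; Laumon 1996, (5.3.2))

Topic `NumberTheory/Automorphic`; namespace `Literature.NumberTheory.Automorphic.HermitianLatticeTree`.  THEOREMS ONLY (no definition, no instance, no notation, no named fact,
no `sorry`).  Cell `pub/hodgecm-mathlib`, F0∕P3a, crux H413 = stmt-HodgeConjecture-24833, line «N6nsGerm», (R2) Euler–Poincaré road, RAMIFIED half, step (S7b) of census
`F0/P3a/A-p06/g27/CENSUS-R2ram-RamifiedEulerPoincare.A-p06g27.md` (LEAD F0P3a-plan (g10) T9-8 (B); seat A-p06 (g27)).  HONEST LABEL: HC_CM is proved only modulo the 2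
remaining named inputs (hLiu418, h413) until rung 0 closes.

SETTING: the lattice tree `latticeTree σ ϖ Φ` of `Φ = !![0,1;1,0]` over a valued field (`σ` valuation-preserving, `ϖ` uniformizing, `𝒪` a DVR); `t ∈ U(Φ)` with
`↑t = diag(ϖ, (σϖ)⁻¹)` (the generator of the split torus modulo its compact part) and `γ ∈ U(Φ)` DIAGONAL WITH UNIT ENTRIES (a non-elliptic regular element of
valuation zero, up to conjugacy); `Φ_t := ⟨perm t⟩ ≤ Perm(V)` acting on vertices and on ordered pairs of vertices.
* §1 `latticeTreePerm_mul`, `latticeTreePerm_zpow`, `latticeTree_adj_smul_iff` — the action is by graph automorphisms; `commute_latticeTreePerm_of_diagonal`.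
* §2 **`natCard_quotient_fixed_add_eq_natCard_quotient_fixedFlags`** — with `F_A = {v | γv = v, v self-dual}`, `F_B = {v | γv = v, v ϖ-modular}` and the fixed flags
  `Fl = {(b, a) | b — a, b ∈ F_B, a ∈ F_A}` (all `Φ_t`-stable), IF the three quotients by `Φ_t` are finite THEN `#(F_A∕Φ_t) + #(F_B∕Φ_t) = #(Fl∕Φ_t)`.
  Proof: ★ `TreeRetraction.exists_retraction` onto the apartment `Y` (★ (S7a) `connected_induce_apartment`), ★ `natCard_quotient_tube` (the off-axis fixed forest is
  matched vertex-to-edge by the parent map, equivariantly), and the axis counts `#(Y_A∕Φ_t) = #(Y_B∕Φ_t) = 1`, `#(Fl_Y∕Φ_t) = 2` (★ (S7a) transitivity, ★ p843347).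
  `…fixedFlags'` — the same with the flags as ordered `(self-dual, ϖ-modular)` pairs `ϖ p.1 ≤ p.2 ≤ p.1` (the target of ★ (S6) `exists_equiv_fixedBy_inf_fixed_flags_apply`).
Consumer (S8): with ★ (S4a) p843359 (`ν(C)⁻¹ Φ(⟦γ⟧, 𝟙_C) = #(Fix_γ(G⧸C)∕τ^ℤ)`), ★ (S4c∕d) p843441 and A-p17's (S6) coset dictionary this is the `hN` binder of ★
`RankOneEulerPoincareGlue.exists_isLocSmooth_classOrbitalIntegral_eq_one_zero_of_relations_congr'` at a tamely ramified (and, verbatim, at an inert) place.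

## References
* [Kottwitz1988] R. E. Kottwitz, *Tamagawa numbers*, Ann. of Math. 127 (1988), §2 Theorem 2.
* [Serre1980Trees] J.-P. Serre, *Trees* (1980), I.6.4 Prop. 24–25, II.1.1.
* [Laumon1995] G. Laumon, *Cohomology of Drinfeld Modular Varieties* I (1996), Lemma (5.3.2).
-/

set_option autoImplicit false

noncomputable section

open NumberField IsDedekindDomain
open scoped Matrix ValuativeRel MatrixGroups
open Matrix ValuativeRel

namespace Literature.NumberTheory.Automorphic.HermitianLatticeTree

open Literature.NumberTheory.Automorphic Literature.NumberTheory.Automorphic.UnitaryGroup Literature.GroupTheory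
open Literature.Combinatorics.SimpleGraph

/-! ## §1 The action of `U(Φ)` on vertices is multiplicative and by graph automorphisms -/

section Action

variable {E : Type*} [Field E] [ValuativeRel E] (σ : E →+* E) (ϖ : E)

/-- `perm (u u′) = perm u ∘ perm u′`. [cite: Serre1980Trees, II.1.1] -/
theorem latticeTreePerm_mul (u u' : unitaryGroupOfForm σ (!![0, 1; 1, 0] : Matrix (Fin 2) (Fin 2) E)) :
    latticeTreePerm σ ϖ (!![0, 1; 1, 0] : Matrix (Fin 2) (Fin 2) E) (u * u') = latticeTreePerm σ ϖ (!![0, 1; 1, 0] : Matrix (Fin 2) (Fin 2) E) u * latticeTreePerm σ ϖ (!![0, 1; 1, 0] : Matrix (Fin 2) (Fin 2) E) u' := by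
  refine Equiv.ext fun v => Subtype.ext ?_
  rw [Equiv.Perm.mul_apply, coe_latticeTreePerm_apply, coe_latticeTreePerm_apply, coe_latticeTreePerm_apply, Subgroup.coe_mul, mapGL_mul]

/-- `perm (t ^ n) = (perm t) ^ n` for `n ∈ ℤ`. [cite: Serre1980Trees, I.6.4] -/
theorem latticeTreePerm_zpow (t : unitaryGroupOfForm σ (!![0, 1; 1, 0] : Matrix (Fin 2) (Fin 2) E)) (n : ℤ) :
    latticeTreePerm σ ϖ (!![0, 1; 1, 0] : Matrix (Fin 2) (Fin 2) E) (t ^ n) = latticeTreePerm σ ϖ (!![0, 1; 1, 0] : Matrix (Fin 2) (Fin 2) E) t ^ n :=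
  map_zpow (MonoidHom.mk' (latticeTreePerm σ ϖ (!![0, 1; 1, 0] : Matrix (Fin 2) (Fin 2) E)) (latticeTreePerm_mul σ ϖ)) t n

/-- **`⟨perm t⟩` acts by graph automorphisms**: `φ·b — φ·a ↔ b — a` for `φ ∈ ⟨perm t⟩`. [cite: Serre1980Trees, II.1.1] -/
theorem latticeTree_adj_smul_iff (t : unitaryGroupOfForm σ (!![0, 1; 1, 0] : Matrix (Fin 2) (Fin 2) E)) (φ : Subgroup.zpowers (latticeTreePerm σ ϖ (!![0, 1; 1, 0] : Matrix (Fin 2) (Fin 2) E) t)) (b a : {M : Submodule 𝒪[E] (Fin 2 → E) // IsSpecialLattice σ ϖ (!![0, 1; 1, 0] : Matrix (Fin 2) (Fin 2) E) M}) :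
    (latticeTree σ ϖ (!![0, 1; 1, 0] : Matrix (Fin 2) (Fin 2) E)).Adj (φ • b) (φ • a) ↔ (latticeTree σ ϖ (!![0, 1; 1, 0] : Matrix (Fin 2) (Fin 2) E)).Adj b a := by
  obtain ⟨n, hn⟩ := Subgroup.mem_zpowers_iff.1 φ.2
  rw [Subgroup.smul_def, Subgroup.smul_def, Equiv.Perm.smul_def, Equiv.Perm.smul_def, ← hn, ← latticeTreePerm_zpow]
  exact (latticeTreeIso σ ϖ (!![0, 1; 1, 0] : Matrix (Fin 2) (Fin 2) E) (t ^ n)).map_adj_iff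

/-- `φ • v = perm (t ^ n) v` for `φ = (perm t)^n`. [cite: Serre1980Trees, I.6.4] -/
theorem exists_smul_eq_latticeTreePerm_zpow (t : unitaryGroupOfForm σ (!![0, 1; 1, 0] : Matrix (Fin 2) (Fin 2) E)) (φ : Subgroup.zpowers (latticeTreePerm σ ϖ (!![0, 1; 1, 0] : Matrix (Fin 2) (Fin 2) E) t)) :
    ∃ n : ℤ, ∀ v : {M : Submodule 𝒪[E] (Fin 2 → E) // IsSpecialLattice σ ϖ (!![0, 1; 1, 0] : Matrix (Fin 2) (Fin 2) E) M}, φ • v = latticeTreePerm σ ϖ (!![0, 1; 1, 0] : Matrix (Fin 2) (Fin 2) E) (t ^ n) v := by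
  obtain ⟨n, hn⟩ := Subgroup.mem_zpowers_iff.1 φ.2
  exact ⟨n, fun v => by rw [Subgroup.smul_def, Equiv.Perm.smul_def, ← hn, latticeTreePerm_zpow]⟩

omit [ValuativeRel E] in
/-- Diagonal elements of `U(Φ)` commute. [cite: Serre1980Trees, II.1.1] -/
theorem commute_of_coe_eq_diagonal {t γ : unitaryGroupOfForm σ (!![0, 1; 1, 0] : Matrix (Fin 2) (Fin 2) E)} {c e : Fin 2 → E}
    (ht : ((t : GL (Fin 2) E) : Matrix (Fin 2) (Fin 2) E) = Matrix.diagonal c) (hγ : ((γ : GL (Fin 2) E) : Matrix (Fin 2) (Fin 2) E) = Matrix.diagonal e) :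
    t * γ = γ * t := by
  apply Subtype.ext
  apply Units.ext
  change ((t : GL (Fin 2) E) : Matrix (Fin 2) (Fin 2) E) * ((γ : GL (Fin 2) E) : Matrix (Fin 2) (Fin 2) E) =
    ((γ : GL (Fin 2) E) : Matrix (Fin 2) (Fin 2) E) * ((t : GL (Fin 2) E) : Matrix (Fin 2) (Fin 2) E)
  rw [ht, hγ, Matrix.diagonal_mul_diagonal, Matrix.diagonal_mul_diagonal]
  congr 1
  funext i
  exact mul_comm _ _

end Action

/-! ## §2 The period count -/

section Period

variable {E : Type*} [Field E] [ValuativeRel E] (σ : E →+* E) (hσv : ∀ x : E, valuation E (σ x) = valuation E x)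
  {ϖ : E} (hϖ : IsUniformizingElement ϖ)

include hσv hϖ in
/-- **«PER PERIOD OF THE TRANSLATION, FIXED VERTICES = FIXED EDGES».**  On the lattice tree of `Φ = antidiag(1,1)` (`σ` valuation-preserving, `ϖ` uniformizing, `𝒪` a
DVR) let `t ∈ U(Φ)` have `↑t = diag(ϖ, (σϖ)⁻¹)` and let `γ ∈ U(Φ)` be diagonal with unit entries; write `Φ_t = ⟨perm t⟩`, `F_A`∕`F_B` for the `γ`-fixed self-dual ∕
`ϖ`-modular vertices and `Fl` for the `γ`-fixed flags `(b — a)`, `b ∈ F_B`, `a ∈ F_A`.  If the three quotients by `Φ_t` are finite, then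
`#(F_A∕Φ_t) + #(F_B∕Φ_t) = #(Fl∕Φ_t)`.  (Retract the fixed forest onto the apartment `Y ⊆ Fix γ`; off the apartment the parent map matches fixed vertices with fixed
edges `Φ_t`-equivariantly, ★ `natCard_quotient_tube`; on the apartment one period carries one self-dual vertex, one modular vertex and two edges.)
[cite: Kottwitz1988, §2 Theorem 2] [cite: Serre1980Trees, I.6.4 Prop. 24–25; II.1.1] [cite: Laumon1995, Lemma (5.3.2)] -/
theorem natCard_quotient_fixed_add_eq_natCard_quotient_fixedFlags [IsDiscreteValuationRing 𝒪[E]]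
    {t γ : unitaryGroupOfForm σ (!![0, 1; 1, 0] : Matrix (Fin 2) (Fin 2) E)} (ht : ((t : GL (Fin 2) E) : Matrix (Fin 2) (Fin 2) E) = Matrix.diagonal ![ϖ, (σ ϖ)⁻¹])
    {e : Fin 2 → E} (hγ : ((γ : GL (Fin 2) E) : Matrix (Fin 2) (Fin 2) E) = Matrix.diagonal e) (he : ∀ i, valuation E (e i) = 1)
    (hfinA : Finite (Quotient ((MulAction.orbitRel (Subgroup.zpowers (latticeTreePerm σ ϖ (!![0, 1; 1, 0] : Matrix (Fin 2) (Fin 2) E) t)) {M : Submodule 𝒪[E] (Fin 2 → E) // IsSpecialLattice σ ϖ (!![0, 1; 1, 0] : Matrix (Fin 2) (Fin 2) E) M}).comap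
      (Subtype.val : {v : {M : Submodule 𝒪[E] (Fin 2 → E) // IsSpecialLattice σ ϖ (!![0, 1; 1, 0] : Matrix (Fin 2) (Fin 2) E) M} | latticeTreeIso σ ϖ (!![0, 1; 1, 0] : Matrix (Fin 2) (Fin 2) E) γ v = v ∧ IsSelfDualLattice σ (!![0, 1; 1, 0] : Matrix (Fin 2) (Fin 2) E) v.1} → {M : Submodule 𝒪[E] (Fin 2 → E) // IsSpecialLattice σ ϖ (!![0, 1; 1, 0] : Matrix (Fin 2) (Fin 2) E) M}))))
    (hfinB : Finite (Quotient ((MulAction.orbitRel (Subgroup.zpowers (latticeTreePerm σ ϖ (!![0, 1; 1, 0] : Matrix (Fin 2) (Fin 2) E) t)) {M : Submodule 𝒪[E] (Fin 2 → E) // IsSpecialLattice σ ϖ (!![0, 1; 1, 0] : Matrix (Fin 2) (Fin 2) E) M}).comap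
      (Subtype.val : {v : {M : Submodule 𝒪[E] (Fin 2 → E) // IsSpecialLattice σ ϖ (!![0, 1; 1, 0] : Matrix (Fin 2) (Fin 2) E) M} | latticeTreeIso σ ϖ (!![0, 1; 1, 0] : Matrix (Fin 2) (Fin 2) E) γ v = v ∧ IsModularLattice σ ϖ (!![0, 1; 1, 0] : Matrix (Fin 2) (Fin 2) E) v.1} → {M : Submodule 𝒪[E] (Fin 2 → E) // IsSpecialLattice σ ϖ (!![0, 1; 1, 0] : Matrix (Fin 2) (Fin 2) E) M}))))
    (hfinF : Finite (Quotient ((MulAction.orbitRel (Subgroup.zpowers (latticeTreePerm σ ϖ (!![0, 1; 1, 0] : Matrix (Fin 2) (Fin 2) E) t)) ({M : Submodule 𝒪[E] (Fin 2 → E) // IsSpecialLattice σ ϖ (!![0, 1; 1, 0] : Matrix (Fin 2) (Fin 2) E) M} × {M : Submodule 𝒪[E] (Fin 2 → E) // IsSpecialLattice σ ϖ (!![0, 1; 1, 0] : Matrix (Fin 2) (Fin 2) E) M})).comap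
      (Subtype.val : {p : {M : Submodule 𝒪[E] (Fin 2 → E) // IsSpecialLattice σ ϖ (!![0, 1; 1, 0] : Matrix (Fin 2) (Fin 2) E) M} × {M : Submodule 𝒪[E] (Fin 2 → E) // IsSpecialLattice σ ϖ (!![0, 1; 1, 0] : Matrix (Fin 2) (Fin 2) E) M} | (latticeTree σ ϖ (!![0, 1; 1, 0] : Matrix (Fin 2) (Fin 2) E)).Adj p.1 p.2 ∧
        p.1 ∈ {v : {M : Submodule 𝒪[E] (Fin 2 → E) // IsSpecialLattice σ ϖ (!![0, 1; 1, 0] : Matrix (Fin 2) (Fin 2) E) M} | latticeTreeIso σ ϖ (!![0, 1; 1, 0] : Matrix (Fin 2) (Fin 2) E) γ v = v ∧ IsModularLattice σ ϖ (!![0, 1; 1, 0] : Matrix (Fin 2) (Fin 2) E) v.1} ∧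
        p.2 ∈ {v : {M : Submodule 𝒪[E] (Fin 2 → E) // IsSpecialLattice σ ϖ (!![0, 1; 1, 0] : Matrix (Fin 2) (Fin 2) E) M} | latticeTreeIso σ ϖ (!![0, 1; 1, 0] : Matrix (Fin 2) (Fin 2) E) γ v = v ∧ IsSelfDualLattice σ (!![0, 1; 1, 0] : Matrix (Fin 2) (Fin 2) E) v.1}} → {M : Submodule 𝒪[E] (Fin 2 → E) // IsSpecialLattice σ ϖ (!![0, 1; 1, 0] : Matrix (Fin 2) (Fin 2) E) M} × {M : Submodule 𝒪[E] (Fin 2 → E) // IsSpecialLattice σ ϖ (!![0, 1; 1, 0] : Matrix (Fin 2) (Fin 2) E) M})))) :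
    Nat.card (Quotient ((MulAction.orbitRel (Subgroup.zpowers (latticeTreePerm σ ϖ (!![0, 1; 1, 0] : Matrix (Fin 2) (Fin 2) E) t)) {M : Submodule 𝒪[E] (Fin 2 → E) // IsSpecialLattice σ ϖ (!![0, 1; 1, 0] : Matrix (Fin 2) (Fin 2) E) M}).comap
        (Subtype.val : {v : {M : Submodule 𝒪[E] (Fin 2 → E) // IsSpecialLattice σ ϖ (!![0, 1; 1, 0] : Matrix (Fin 2) (Fin 2) E) M} | latticeTreeIso σ ϖ (!![0, 1; 1, 0] : Matrix (Fin 2) (Fin 2) E) γ v = v ∧ IsSelfDualLattice σ (!![0, 1; 1, 0] : Matrix (Fin 2) (Fin 2) E) v.1} → {M : Submodule 𝒪[E] (Fin 2 → E) // IsSpecialLattice σ ϖ (!![0, 1; 1, 0] : Matrix (Fin 2) (Fin 2) E) M}))) +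
      Nat.card (Quotient ((MulAction.orbitRel (Subgroup.zpowers (latticeTreePerm σ ϖ (!![0, 1; 1, 0] : Matrix (Fin 2) (Fin 2) E) t)) {M : Submodule 𝒪[E] (Fin 2 → E) // IsSpecialLattice σ ϖ (!![0, 1; 1, 0] : Matrix (Fin 2) (Fin 2) E) M}).comap
        (Subtype.val : {v : {M : Submodule 𝒪[E] (Fin 2 → E) // IsSpecialLattice σ ϖ (!![0, 1; 1, 0] : Matrix (Fin 2) (Fin 2) E) M} | latticeTreeIso σ ϖ (!![0, 1; 1, 0] : Matrix (Fin 2) (Fin 2) E) γ v = v ∧ IsModularLattice σ ϖ (!![0, 1; 1, 0] : Matrix (Fin 2) (Fin 2) E) v.1} → {M : Submodule 𝒪[E] (Fin 2 → E) // IsSpecialLattice σ ϖ (!![0, 1; 1, 0] : Matrix (Fin 2) (Fin 2) E) M}))) =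
      Nat.card (Quotient ((MulAction.orbitRel (Subgroup.zpowers (latticeTreePerm σ ϖ (!![0, 1; 1, 0] : Matrix (Fin 2) (Fin 2) E) t)) ({M : Submodule 𝒪[E] (Fin 2 → E) // IsSpecialLattice σ ϖ (!![0, 1; 1, 0] : Matrix (Fin 2) (Fin 2) E) M} × {M : Submodule 𝒪[E] (Fin 2 → E) // IsSpecialLattice σ ϖ (!![0, 1; 1, 0] : Matrix (Fin 2) (Fin 2) E) M})).comap
        (Subtype.val : {p : {M : Submodule 𝒪[E] (Fin 2 → E) // IsSpecialLattice σ ϖ (!![0, 1; 1, 0] : Matrix (Fin 2) (Fin 2) E) M} × {M : Submodule 𝒪[E] (Fin 2 → E) // IsSpecialLattice σ ϖ (!![0, 1; 1, 0] : Matrix (Fin 2) (Fin 2) E) M} | (latticeTree σ ϖ (!![0, 1; 1, 0] : Matrix (Fin 2) (Fin 2) E)).Adj p.1 p.2 ∧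
          p.1 ∈ {v : {M : Submodule 𝒪[E] (Fin 2 → E) // IsSpecialLattice σ ϖ (!![0, 1; 1, 0] : Matrix (Fin 2) (Fin 2) E) M} | latticeTreeIso σ ϖ (!![0, 1; 1, 0] : Matrix (Fin 2) (Fin 2) E) γ v = v ∧ IsModularLattice σ ϖ (!![0, 1; 1, 0] : Matrix (Fin 2) (Fin 2) E) v.1} ∧
          p.2 ∈ {v : {M : Submodule 𝒪[E] (Fin 2 → E) // IsSpecialLattice σ ϖ (!![0, 1; 1, 0] : Matrix (Fin 2) (Fin 2) E) M} | latticeTreeIso σ ϖ (!![0, 1; 1, 0] : Matrix (Fin 2) (Fin 2) E) γ v = v ∧ IsSelfDualLattice σ (!![0, 1; 1, 0] : Matrix (Fin 2) (Fin 2) E) v.1}} → {M : Submodule 𝒪[E] (Fin 2 → E) // IsSpecialLattice σ ϖ (!![0, 1; 1, 0] : Matrix (Fin 2) (Fin 2) E) M} × {M : Submodule 𝒪[E] (Fin 2 → E) // IsSpecialLattice σ ϖ (!![0, 1; 1, 0] : Matrix (Fin 2) (Fin 2) E) M}))) := by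
  classical
  have hΦu := isUnimodular₂_antidiag (E := E)
  have hdisj : ∀ M : Submodule 𝒪[E] (Fin 2 → E), IsSelfDualLattice σ (!![0, 1; 1, 0] : Matrix (Fin 2) (Fin 2) E) M → IsModularLattice σ ϖ (!![0, 1; 1, 0] : Matrix (Fin 2) (Fin 2) E) M → False :=
    fun M h1 h2 => not_isModularLattice_of_isSelfDualLattice σ hσv hϖ _ h1 h2
  -- the fixed-point equation in `perm` form
  have hfix : ∀ v : {M : Submodule 𝒪[E] (Fin 2 → E) // IsSpecialLattice σ ϖ (!![0, 1; 1, 0] : Matrix (Fin 2) (Fin 2) E) M}, latticeTreeIso σ ϖ (!![0, 1; 1, 0] : Matrix (Fin 2) (Fin 2) E) γ v = v ↔ latticeTreePerm σ ϖ (!![0, 1; 1, 0] : Matrix (Fin 2) (Fin 2) E) γ v = v := fun v => Iff.rfl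
  -- (({v : {M : Submodule 𝒪[E] (Fin 2 → E) // IsSpecialLattice σ ϖ (!![0, 1; 1, 0] : Matrix (Fin 2) (Fin 2) E) M} | ∃ a b : ℤ, (a + b = 0 ∨ a + b = 1) ∧ v.1 = latt (Matrix.diagonal ![ϖ ^ a, ϖ ^ b])})) structure of the apartment
  have hYAY : ∀ v, v ∈ ({v : {M : Submodule 𝒪[E] (Fin 2 → E) // IsSpecialLattice σ ϖ (!![0, 1; 1, 0] : Matrix (Fin 2) (Fin 2) E) M} | ∃ a b : ℤ, a + b = 0 ∧ v.1 = latt (Matrix.diagonal ![ϖ ^ a, ϖ ^ b])}) → v ∈ ({v : {M : Submodule 𝒪[E] (Fin 2 → E) // IsSpecialLattice σ ϖ (!![0, 1; 1, 0] : Matrix (Fin 2) (Fin 2) E) M} | ∃ a b : ℤ, (a + b = 0 ∨ a + b = 1) ∧ v.1 = latt (Matrix.diagonal ![ϖ ^ a, ϖ ^ b])}) := fun v ⟨a, b, hab, hv⟩ => ⟨a, b, Or.inl hab, hv⟩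
  have hYBY : ∀ v, v ∈ ({v : {M : Submodule 𝒪[E] (Fin 2 → E) // IsSpecialLattice σ ϖ (!![0, 1; 1, 0] : Matrix (Fin 2) (Fin 2) E) M} | ∃ a b : ℤ, a + b = 1 ∧ v.1 = latt (Matrix.diagonal ![ϖ ^ a, ϖ ^ b])}) → v ∈ ({v : {M : Submodule 𝒪[E] (Fin 2 → E) // IsSpecialLattice σ ϖ (!![0, 1; 1, 0] : Matrix (Fin 2) (Fin 2) E) M} | ∃ a b : ℤ, (a + b = 0 ∨ a + b = 1) ∧ v.1 = latt (Matrix.diagonal ![ϖ ^ a, ϖ ^ b])}) := fun v ⟨a, b, hab, hv⟩ => ⟨a, b, Or.inr hab, hv⟩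
  have hY_cases : ∀ v, v ∈ ({v : {M : Submodule 𝒪[E] (Fin 2 → E) // IsSpecialLattice σ ϖ (!![0, 1; 1, 0] : Matrix (Fin 2) (Fin 2) E) M} | ∃ a b : ℤ, (a + b = 0 ∨ a + b = 1) ∧ v.1 = latt (Matrix.diagonal ![ϖ ^ a, ϖ ^ b])}) → v ∈ ({v : {M : Submodule 𝒪[E] (Fin 2 → E) // IsSpecialLattice σ ϖ (!![0, 1; 1, 0] : Matrix (Fin 2) (Fin 2) E) M} | ∃ a b : ℤ, a + b = 0 ∧ v.1 = latt (Matrix.diagonal ![ϖ ^ a, ϖ ^ b])}) ∨ v ∈ ({v : {M : Submodule 𝒪[E] (Fin 2 → E) // IsSpecialLattice σ ϖ (!![0, 1; 1, 0] : Matrix (Fin 2) (Fin 2) E) M} | ∃ a b : ℤ, a + b = 1 ∧ v.1 = latt (Matrix.diagonal ![ϖ ^ a, ϖ ^ b])}) := fun v ⟨a, b, hab, hv⟩ => hab.elim (fun h => Or.inl ⟨a, b, h, hv⟩) fun h => Or.inr ⟨a, b, h, hv⟩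
  have hYAsd : ∀ v, v ∈ ({v : {M : Submodule 𝒪[E] (Fin 2 → E) // IsSpecialLattice σ ϖ (!![0, 1; 1, 0] : Matrix (Fin 2) (Fin 2) E) M} | ∃ a b : ℤ, a + b = 0 ∧ v.1 = latt (Matrix.diagonal ![ϖ ^ a, ϖ ^ b])}) → IsSelfDualLattice σ (!![0, 1; 1, 0] : Matrix (Fin 2) (Fin 2) E) v.1 := fun v ⟨a, b, hab, hv⟩ => hv ▸ isSelfDualLattice_latt_diagonal_zpow σ hσv hϖ hab
  have hYBmd : ∀ v, v ∈ ({v : {M : Submodule 𝒪[E] (Fin 2 → E) // IsSpecialLattice σ ϖ (!![0, 1; 1, 0] : Matrix (Fin 2) (Fin 2) E) M} | ∃ a b : ℤ, a + b = 1 ∧ v.1 = latt (Matrix.diagonal ![ϖ ^ a, ϖ ^ b])}) → IsModularLattice σ ϖ (!![0, 1; 1, 0] : Matrix (Fin 2) (Fin 2) E) v.1 := fun v ⟨a, b, hab, hv⟩ => hv ▸ isModularLattice_latt_diagonal_zpow σ hσv hϖ hab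
  have hYAfix : ∀ v, v ∈ ({v : {M : Submodule 𝒪[E] (Fin 2 → E) // IsSpecialLattice σ ϖ (!![0, 1; 1, 0] : Matrix (Fin 2) (Fin 2) E) M} | ∃ a b : ℤ, a + b = 0 ∧ v.1 = latt (Matrix.diagonal ![ϖ ^ a, ϖ ^ b])}) → latticeTreePerm σ ϖ (!![0, 1; 1, 0] : Matrix (Fin 2) (Fin 2) E) γ v = v :=
    fun v ⟨a, b, _, hv⟩ => latticeTreePerm_apply_eq_self_of_mem_apartment σ hϖ hγ he v ⟨a, b, hv⟩
  have hYBfix : ∀ v, v ∈ ({v : {M : Submodule 𝒪[E] (Fin 2 → E) // IsSpecialLattice σ ϖ (!![0, 1; 1, 0] : Matrix (Fin 2) (Fin 2) E) M} | ∃ a b : ℤ, a + b = 1 ∧ v.1 = latt (Matrix.diagonal ![ϖ ^ a, ϖ ^ b])}) → latticeTreePerm σ ϖ (!![0, 1; 1, 0] : Matrix (Fin 2) (Fin 2) E) γ v = v :=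
    fun v ⟨a, b, _, hv⟩ => latticeTreePerm_apply_eq_self_of_mem_apartment σ hϖ hγ he v ⟨a, b, hv⟩
  have hYAFA : ({v : {M : Submodule 𝒪[E] (Fin 2 → E) // IsSpecialLattice σ ϖ (!![0, 1; 1, 0] : Matrix (Fin 2) (Fin 2) E) M} | ∃ a b : ℤ, a + b = 0 ∧ v.1 = latt (Matrix.diagonal ![ϖ ^ a, ϖ ^ b])}) ⊆ ({v : {M : Submodule 𝒪[E] (Fin 2 → E) // IsSpecialLattice σ ϖ (!![0, 1; 1, 0] : Matrix (Fin 2) (Fin 2) E) M} | latticeTreeIso σ ϖ (!![0, 1; 1, 0] : Matrix (Fin 2) (Fin 2) E) γ v = v ∧ IsSelfDualLattice σ (!![0, 1; 1, 0] : Matrix (Fin 2) (Fin 2) E) v.1}) := fun v hv => ⟨hYAfix v hv, hYAsd v hv⟩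
  have hYBFB : ({v : {M : Submodule 𝒪[E] (Fin 2 → E) // IsSpecialLattice σ ϖ (!![0, 1; 1, 0] : Matrix (Fin 2) (Fin 2) E) M} | ∃ a b : ℤ, a + b = 1 ∧ v.1 = latt (Matrix.diagonal ![ϖ ^ a, ϖ ^ b])}) ⊆ ({v : {M : Submodule 𝒪[E] (Fin 2 → E) // IsSpecialLattice σ ϖ (!![0, 1; 1, 0] : Matrix (Fin 2) (Fin 2) E) M} | latticeTreeIso σ ϖ (!![0, 1; 1, 0] : Matrix (Fin 2) (Fin 2) E) γ v = v ∧ IsModularLattice σ ϖ (!![0, 1; 1, 0] : Matrix (Fin 2) (Fin 2) E) v.1}) := fun v hv => ⟨hYBfix v hv, hYBmd v hv⟩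
  -- self-dual points of `({v : {M : Submodule 𝒪[E] (Fin 2 → E) // IsSpecialLattice σ ϖ (!![0, 1; 1, 0] : Matrix (Fin 2) (Fin 2) E) M} | ∃ a b : ℤ, (a + b = 0 ∨ a + b = 1) ∧ v.1 = latt (Matrix.diagonal ![ϖ ^ a, ϖ ^ b])})` lie in `({v : {M : Submodule 𝒪[E] (Fin 2 → E) // IsSpecialLattice σ ϖ (!![0, 1; 1, 0] : Matrix (Fin 2) (Fin 2) E) M} | ∃ a b : ℤ, a + b = 0 ∧ v.1 = latt (Matrix.diagonal ![ϖ ^ a, ϖ ^ b])})`, modular ones in `({v : {M : Submodule 𝒪[E] (Fin 2 → E) // IsSpecialLattice σ ϖ (!![0, 1; 1, 0] : Matrix (Fin 2) (Fin 2) E) M} | ∃ a b : ℤ, a + b = 1 ∧ v.1 = latt (Matrix.diagonal ![ϖ ^ a, ϖ ^ b])})`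
  have hY_A : ∀ v, v ∈ ({v : {M : Submodule 𝒪[E] (Fin 2 → E) // IsSpecialLattice σ ϖ (!![0, 1; 1, 0] : Matrix (Fin 2) (Fin 2) E) M} | ∃ a b : ℤ, (a + b = 0 ∨ a + b = 1) ∧ v.1 = latt (Matrix.diagonal ![ϖ ^ a, ϖ ^ b])}) → IsSelfDualLattice σ (!![0, 1; 1, 0] : Matrix (Fin 2) (Fin 2) E) v.1 → v ∈ ({v : {M : Submodule 𝒪[E] (Fin 2 → E) // IsSpecialLattice σ ϖ (!![0, 1; 1, 0] : Matrix (Fin 2) (Fin 2) E) M} | ∃ a b : ℤ, a + b = 0 ∧ v.1 = latt (Matrix.diagonal ![ϖ ^ a, ϖ ^ b])}) := fun v hv hs =>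
    (hY_cases v hv).elim id fun h => (hdisj _ hs (hYBmd v h)).elim
  have hY_B : ∀ v, v ∈ ({v : {M : Submodule 𝒪[E] (Fin 2 → E) // IsSpecialLattice σ ϖ (!![0, 1; 1, 0] : Matrix (Fin 2) (Fin 2) E) M} | ∃ a b : ℤ, (a + b = 0 ∨ a + b = 1) ∧ v.1 = latt (Matrix.diagonal ![ϖ ^ a, ϖ ^ b])}) → IsModularLattice σ ϖ (!![0, 1; 1, 0] : Matrix (Fin 2) (Fin 2) E) v.1 → v ∈ ({v : {M : Submodule 𝒪[E] (Fin 2 → E) // IsSpecialLattice σ ϖ (!![0, 1; 1, 0] : Matrix (Fin 2) (Fin 2) E) M} | ∃ a b : ℤ, a + b = 1 ∧ v.1 = latt (Matrix.diagonal ![ϖ ^ a, ϖ ^ b])}) := fun v hv hm =>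
    (hY_cases v hv).elim (fun h => (hdisj _ (hYAsd v h) hm).elim) id
  -- (Φ) the translation group: invariance of `({v : {M : Submodule 𝒪[E] (Fin 2 → E) // IsSpecialLattice σ ϖ (!![0, 1; 1, 0] : Matrix (Fin 2) (Fin 2) E) M} | ∃ a b : ℤ, a + b = 0 ∧ v.1 = latt (Matrix.diagonal ![ϖ ^ a, ϖ ^ b])})`, `({v : {M : Submodule 𝒪[E] (Fin 2 → E) // IsSpecialLattice σ ϖ (!![0, 1; 1, 0] : Matrix (Fin 2) (Fin 2) E) M} | ∃ a b : ℤ, a + b = 1 ∧ v.1 = latt (Matrix.diagonal ![ϖ ^ a, ϖ ^ b])})`, `({v : {M : Submodule 𝒪[E] (Fin 2 → E) // IsSpecialLattice σ ϖ (!![0, 1; 1, 0] : Matrix (Fin 2) (Fin 2) E) M} | ∃ a b : ℤ, (a + b = 0 ∨ a + b = 1) ∧ v.1 = latt (Matrix.diagonal ![ϖ ^ a, ϖ ^ b])})`, `({v : {M : Submodule 𝒪[E] (Fin 2 → E) // IsSpecialLattice σ ϖ (!![0, 1; 1, 0] : Matrix (Fin 2) (Fin 2) E) M} | latticeTreeIso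 σ ϖ (!![0, 1; 1, 0] : Matrix (Fin 2) (Fin 2) E) γ v = v ∧ IsSelfDualLattice σ (!![0, 1; 1, 0] : Matrix (Fin 2) (Fin 2) E) v.1})`, `({v : {M : Submodule 𝒪[E] (Fin 2 → E) // IsSpecialLattice σ ϖ (!![0, 1; 1, 0] : Matrix (Fin 2) (Fin 2) E) M} | latticeTreeIso σ ϖ (!![0, 1; 1, 0] : Matrix (Fin 2) (Fin 2) E) γ v = v ∧ IsModularLattice σ ϖ (!![0, 1; 1, 0] : Matrix (Fin 2) (Fin 2) E) v.1})`
  have hcomm : t * γ = γ * t := commute_of_coe_eq_diagonal σ ht hγ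
  have hYAi : ∀ (φ : Subgroup.zpowers (latticeTreePerm σ ϖ (!![0, 1; 1, 0] : Matrix (Fin 2) (Fin 2) E) t)) (v : {M : Submodule 𝒪[E] (Fin 2 → E) // IsSpecialLattice σ ϖ (!![0, 1; 1, 0] : Matrix (Fin 2) (Fin 2) E) M}), v ∈ ({v : {M : Submodule 𝒪[E] (Fin 2 → E) // IsSpecialLattice σ ϖ (!![0, 1; 1, 0] : Matrix (Fin 2) (Fin 2) E) M} | ∃ a b : ℤ, a + b = 0 ∧ v.1 = latt (Matrix.diagonal ![ϖ ^ a, ϖ ^ b])}) → φ • v ∈ ({v : {M : Submodule 𝒪[E] (Fin 2 → E) // IsSpecialLattice σ ϖ (!![0, 1; 1, 0] : Matrix (Fin 2) (Fin 2) E) M} | ∃ a b : ℤ, a + b = 0 ∧ v.1 = latt (Matrix.diagonal ![ϖ ^ a, ϖ ^ b])}) :=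
    fun φ v hv => smul_mem_apartment_of_mem_zpowers σ hσv hϖ ht 0 φ v hv
  have hYBi : ∀ (φ : Subgroup.zpowers (latticeTreePerm σ ϖ (!![0, 1; 1, 0] : Matrix (Fin 2) (Fin 2) E) t)) (v : {M : Submodule 𝒪[E] (Fin 2 → E) // IsSpecialLattice σ ϖ (!![0, 1; 1, 0] : Matrix (Fin 2) (Fin 2) E) M}), v ∈ ({v : {M : Submodule 𝒪[E] (Fin 2 → E) // IsSpecialLattice σ ϖ (!![0, 1; 1, 0] : Matrix (Fin 2) (Fin 2) E) M} | ∃ a b : ℤ, a + b = 1 ∧ v.1 = latt (Matrix.diagonal ![ϖ ^ a, ϖ ^ b])}) → φ • v ∈ ({v : {M : Submodule 𝒪[E] (Fin 2 → E) // IsSpecialLattice σ ϖ (!![0, 1; 1, 0] : Matrix (Fin 2) (Fin 2) E) M} | ∃ a b : ℤ, a + b = 1 ∧ v.1 = latt (Matrix.diagonal ![ϖ ^ a, ϖ ^ b])}) :=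
    fun φ v hv => smul_mem_apartment_of_mem_zpowers σ hσv hϖ ht 1 φ v hv
  have hYi : ∀ (φ : Subgroup.zpowers (latticeTreePerm σ ϖ (!![0, 1; 1, 0] : Matrix (Fin 2) (Fin 2) E) t)) (v : {M : Submodule 𝒪[E] (Fin 2 → E) // IsSpecialLattice σ ϖ (!![0, 1; 1, 0] : Matrix (Fin 2) (Fin 2) E) M}), v ∈ ({v : {M : Submodule 𝒪[E] (Fin 2 → E) // IsSpecialLattice σ ϖ (!![0, 1; 1, 0] : Matrix (Fin 2) (Fin 2) E) M} | ∃ a b : ℤ, (a + b = 0 ∨ a + b = 1) ∧ v.1 = latt (Matrix.diagonal ![ϖ ^ a, ϖ ^ b])}) → φ • v ∈ ({v : {M : Submodule 𝒪[E] (Fin 2 → E) // IsSpecialLattice σ ϖ (!![0, 1; 1, 0] : Matrix (Fin 2) (Fin 2) E) M} | ∃ a b : ℤ, (a + b = 0 ∨ a + b = 1) ∧ v.1 = latt (Matrix.diagonal ![ϖ ^ a, ϖ ^ b])}) :=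
    fun φ v hv => (hY_cases v hv).elim (fun h => hYAY _ (hYAi φ v h)) fun h => hYBY _ (hYBi φ v h)
  have hfixi : ∀ (φ : Subgroup.zpowers (latticeTreePerm σ ϖ (!![0, 1; 1, 0] : Matrix (Fin 2) (Fin 2) E) t)) (v : {M : Submodule 𝒪[E] (Fin 2 → E) // IsSpecialLattice σ ϖ (!![0, 1; 1, 0] : Matrix (Fin 2) (Fin 2) E) M}), latticeTreePerm σ ϖ (!![0, 1; 1, 0] : Matrix (Fin 2) (Fin 2) E) γ v = v → latticeTreePerm σ ϖ (!![0, 1; 1, 0] : Matrix (Fin 2) (Fin 2) E) γ (φ • v) = φ • v := by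
    intro φ v hv
    obtain ⟨n, hn⟩ := exists_smul_eq_latticeTreePerm_zpow σ ϖ t φ
    rw [hn]
    have hc : γ * t ^ n = t ^ n * γ := by
      have h := (Commute.symm (show Commute t γ from hcomm)).zpow_right n
      exact h.eq
    have h1 : latticeTreePerm σ ϖ (!![0, 1; 1, 0] : Matrix (Fin 2) (Fin 2) E) γ (latticeTreePerm σ ϖ (!![0, 1; 1, 0] : Matrix (Fin 2) (Fin 2) E) (t ^ n) v) = latticeTreePerm σ ϖ (!![0, 1; 1, 0] : Matrix (Fin 2) (Fin 2) E) (γ * t ^ n) v := by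
      rw [latticeTreePerm_mul, Equiv.Perm.mul_apply]
    rw [h1, hc, latticeTreePerm_mul, Equiv.Perm.mul_apply, hv]
  have hFAi : ∀ (φ : Subgroup.zpowers (latticeTreePerm σ ϖ (!![0, 1; 1, 0] : Matrix (Fin 2) (Fin 2) E) t)) (v : {M : Submodule 𝒪[E] (Fin 2 → E) // IsSpecialLattice σ ϖ (!![0, 1; 1, 0] : Matrix (Fin 2) (Fin 2) E) M}), v ∈ ({v : {M : Submodule 𝒪[E] (Fin 2 → E) // IsSpecialLattice σ ϖ (!![0, 1; 1, 0] : Matrix (Fin 2) (Fin 2) E) M} | latticeTreeIso σ ϖ (!![0, 1; 1, 0] : Matrix (Fin 2) (Fin 2) E) γ v = v ∧ IsSelfDualLattice σ (!![0, 1; 1, 0] : Matrix (Fin 2) (Fin 2) E) v.1}) → φ • v ∈ ({v : {M : Submodule 𝒪[E] (Fin 2 → E) // IsSpecialLattice σ ϖ (!![0, 1; 1, 0] : Matrix (Fin 2) (Fin 2) E) M} | latticeTreeIso σ ϖ (!![0, 1; 1, 0] : Matrix (Fin 2) (Fin 2) E) γ v = v ∧ IsSelfDualLattice σ (!![0, 1;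 1, 0] : Matrix (Fin 2) (Fin 2) E) v.1}) := by
    rintro φ v ⟨hv, hs⟩
    obtain ⟨n, hn⟩ := exists_smul_eq_latticeTreePerm_zpow σ ϖ t φ
    refine ⟨hfixi φ v hv, ?_⟩
    rw [hn, coe_latticeTreePerm_apply]
    exact isSelfDualLattice_mapGL σ _ _ (t ^ n).2 hs
  have hFBi : ∀ (φ : Subgroup.zpowers (latticeTreePerm σ ϖ (!![0, 1; 1, 0] : Matrix (Fin 2) (Fin 2) E) t)) (v : {M : Submodule 𝒪[E] (Fin 2 → E) // IsSpecialLattice σ ϖ (!![0, 1; 1, 0] : Matrix (Fin 2) (Fin 2) E) M}), v ∈ ({v : {M : Submodule 𝒪[E] (Fin 2 → E) // IsSpecialLattice σ ϖ (!![0, 1; 1, 0] : Matrix (Fin 2) (Fin 2) E) M} | latticeTreeIso σ ϖ (!![0, 1; 1, 0] : Matrix (Fin 2) (Fin 2) E) γ v = v ∧ IsModularLattice σ ϖ (!![0, 1; 1, 0] : Matrix (Fin 2) (Fin 2) E) v.1}) → φ • v ∈ ({v : {M : Submodule 𝒪[E] (Fin 2 → E) // IsSpecialLattice σ ϖ (!![0,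 1; 1, 0] : Matrix (Fin 2) (Fin 2) E) M} | latticeTreeIso σ ϖ (!![0, 1; 1, 0] : Matrix (Fin 2) (Fin 2) E) γ v = v ∧ IsModularLattice σ ϖ (!![0, 1; 1, 0] : Matrix (Fin 2) (Fin 2) E) v.1}) := by
    rintro φ v ⟨hv, hm⟩
    obtain ⟨n, hn⟩ := exists_smul_eq_latticeTreePerm_zpow σ ϖ t φ
    refine ⟨hfixi φ v hv, ?_⟩
    rw [hn, coe_latticeTreePerm_apply]
    exact isModularLattice_mapGL σ ϖ _ _ (t ^ n).2 hm
  -- `φ` and `γ` as graph automorphisms preserving `({v : {M : Submodule 𝒪[E] (Fin 2 → E) // IsSpecialLattice σ ϖ (!![0, 1; 1, 0] : Matrix (Fin 2) (Fin 2) E) M} | ∃ a b : ℤ, (a + b = 0 ∨ a + b = 1) ∧ v.1 = latt (Matrix.diagonal ![ϖ ^ a, ϖ ^ b])})`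
  have hYiff : ∀ (φ : Subgroup.zpowers (latticeTreePerm σ ϖ (!![0, 1; 1, 0] : Matrix (Fin 2) (Fin 2) E) t)) (v : {M : Submodule 𝒪[E] (Fin 2 → E) // IsSpecialLattice σ ϖ (!![0, 1; 1, 0] : Matrix (Fin 2) (Fin 2) E) M}), φ • v ∈ ({v : {M : Submodule 𝒪[E] (Fin 2 → E) // IsSpecialLattice σ ϖ (!![0, 1; 1, 0] : Matrix (Fin 2) (Fin 2) E) M} | ∃ a b : ℤ, (a + b = 0 ∨ a + b = 1) ∧ v.1 = latt (Matrix.diagonal ![ϖ ^ a, ϖ ^ b])}) ↔ v ∈ ({v : {M : Submodule 𝒪[E] (Fin 2 → E) // IsSpecialLattice σ ϖ (!![0, 1; 1, 0] : Matrix (Fin 2) (Fin 2) E) M} | ∃ a b : ℤ, (a + b = 0 ∨ a + b = 1) ∧ v.1 = latt (Matrix.diagonal ![ϖ ^ a, ϖ ^ b])}) := by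
    intro φ v
    refine ⟨fun h => ?_, hYi φ v⟩
    have h' := hYi φ⁻¹ _ h
    rwa [inv_smul_smul] at h'
  -- (T) the tree and the retraction onto `({v : {M : Submodule 𝒪[E] (Fin 2 → E) // IsSpecialLattice σ ϖ (!![0, 1; 1, 0] : Matrix (Fin 2) (Fin 2) E) M} | ∃ a b : ℤ, (a + b = 0 ∨ a + b = 1) ∧ v.1 = latt (Matrix.diagonal ![ϖ ^ a, ϖ ^ b])})`
  have hT : (latticeTree σ ϖ (!![0, 1; 1, 0] : Matrix (Fin 2) (Fin 2) E)).IsTree := isTree_latticeTree σ hσv hϖ hΦu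
  have hYne : ({v : {M : Submodule 𝒪[E] (Fin 2 → E) // IsSpecialLattice σ ϖ (!![0, 1; 1, 0] : Matrix (Fin 2) (Fin 2) E) M} | ∃ a b : ℤ, (a + b = 0 ∨ a + b = 1) ∧ v.1 = latt (Matrix.diagonal ![ϖ ^ a, ϖ ^ b])}).Nonempty :=
    ⟨⟨latt (Matrix.diagonal ![ϖ ^ (0 : ℤ), ϖ ^ (0 : ℤ)]), Or.inl (isSelfDualLattice_latt_diagonal_zpow σ hσv hϖ (by norm_num))⟩, 0, 0, Or.inl (by norm_num), rfl⟩
  have hYc : ((latticeTree σ ϖ (!![0, 1; 1, 0] : Matrix (Fin 2) (Fin 2) E)).induce ({v : {M : Submodule 𝒪[E] (Fin 2 → E) // IsSpecialLattice σ ϖ (!![0, 1; 1, 0] : Matrix (Fin 2) (Fin 2) E) M} | ∃ a b : ℤ, (a + b = 0 ∨ a + b = 1) ∧ v.1 = latt (Matrix.diagonal ![ϖ ^ a, ϖ ^ b])})).Connected := connected_induce_apartment σ hσv hϖ ({v : {M : Submodule 𝒪[E] (Fin 2 → E) // IsSpecialLattice σ ϖ (!![0, 1; 1, 0] : Matrix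 (Fin 2) (Fin 2) E) M} | ∃ a b : ℤ, (a + b = 0 ∨ a + b = 1) ∧ v.1 = latt (Matrix.diagonal ![ϖ ^ a, ϖ ^ b])}) fun v => Iff.rfl
  obtain ⟨h, p, -, hzero, hpar, hedgeY, -, hequiv⟩ := TreeRetraction.exists_retraction hT hYne hYc
  -- equivariance of `p` under `φ ∈ ⟨perm t⟩` and under `γ`
  have hpφ : ∀ (φ : Subgroup.zpowers (latticeTreePerm σ ϖ (!![0, 1; 1, 0] : Matrix (Fin 2) (Fin 2) E) t)) (v : {M : Submodule 𝒪[E] (Fin 2 → E) // IsSpecialLattice σ ϖ (!![0, 1; 1, 0] : Matrix (Fin 2) (Fin 2) E) M}), v ∉ ({v : {M : Submodule 𝒪[E] (Fin 2 → E) // IsSpecialLattice σ ϖ (!![0, 1; 1, 0] : Matrix (Fin 2) (Fin 2) E) M} | ∃ a b : ℤ, (a + b = 0 ∨ a + b = 1) ∧ v.1 = latt (Matrix.diagonal ![ϖ ^ a, ϖ ^ b])}) → p (φ • v) = φ • p v := by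
    intro φ v hv
    obtain ⟨n, hn⟩ := exists_smul_eq_latticeTreePerm_zpow σ ϖ t φ
    have hY' : ∀ w : {M : Submodule 𝒪[E] (Fin 2 → E) // IsSpecialLattice σ ϖ (!![0, 1; 1, 0] : Matrix (Fin 2) (Fin 2) E) M}, latticeTreeIso σ ϖ (!![0, 1; 1, 0] : Matrix (Fin 2) (Fin 2) E) (t ^ n) w ∈ ({v : {M : Submodule 𝒪[E] (Fin 2 → E) // IsSpecialLattice σ ϖ (!![0, 1; 1, 0] : Matrix (Fin 2) (Fin 2) E) M} | ∃ a b : ℤ, (a + b = 0 ∨ a + b = 1) ∧ v.1 = latt (Matrix.diagonal ![ϖ ^ a, ϖ ^ b])}) ↔ w ∈ ({v : {M : Submodule 𝒪[E] (Fin 2 → E) // IsSpecialLattice σ ϖ (!![0, 1; 1, 0] : Matrix (Fin 2) (Fin 2) E) M} | ∃ a b : ℤ, (a + b = 0 ∨ a + b = 1) ∧ v.1 = latt (Matrix.diagonal ![ϖ ^ a, ϖ ^ b])}) := fun w => by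
      have h := hYiff φ w; rwa [hn w] at h
    have h2 := ((hequiv (latticeTreeIso σ ϖ (!![0, 1; 1, 0] : Matrix (Fin 2) (Fin 2) E) (t ^ n)) hY') v).2 hv
    rw [hn, hn]
    exact h2
  have hγY : ∀ w : {M : Submodule 𝒪[E] (Fin 2 → E) // IsSpecialLattice σ ϖ (!![0, 1; 1, 0] : Matrix (Fin 2) (Fin 2) E) M}, latticeTreeIso σ ϖ (!![0, 1; 1, 0] : Matrix (Fin 2) (Fin 2) E) γ w ∈ ({v : {M : Submodule 𝒪[E] (Fin 2 → E) // IsSpecialLattice σ ϖ (!![0, 1; 1, 0] : Matrix (Fin 2) (Fin 2) E) M} | ∃ a b : ℤ, (a + b = 0 ∨ a + b = 1) ∧ v.1 = latt (Matrix.diagonal ![ϖ ^ a, ϖ ^ b])}) ↔ w ∈ ({v : {M : Submodule 𝒪[E] (Fin 2 → E) // IsSpecialLattice σ ϖ (!![0, 1; 1, 0] : Matrix (Fin 2) (Fin 2) E) M} | ∃ a b : ℤ, (a + b = 0 ∨ a + b = 1) ∧ v.1 = latt (Matrix.diagonal ![ϖ ^ a, ϖ ^ b])}) := by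
    intro w
    constructor
    · intro hw
      -- `γ` fixes `({v : {M : Submodule 𝒪[E] (Fin 2 → E) // IsSpecialLattice σ ϖ (!![0, 1; 1, 0] : Matrix (Fin 2) (Fin 2) E) M} | ∃ a b : ℤ, (a + b = 0 ∨ a + b = 1) ∧ v.1 = latt (Matrix.diagonal ![ϖ ^ a, ϖ ^ b])})` pointwise, so `γ w ∈ ({v : {M : Submodule 𝒪[E] (Fin 2 → E) // IsSpecialLattice σ ϖ (!![0, 1; 1, 0] : Matrix (Fin 2) (Fin 2) E) M} | ∃ a b : ℤ, (a + b = 0 ∨ a + b = 1) ∧ v.1 = latt (Matrix.diagonal ![ϖ ^ a, ϖ ^ b])}) ⇒ γ(γ w) = γ w ⇒ γ w = w`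
      have hfw : latticeTreePerm σ ϖ (!![0, 1; 1, 0] : Matrix (Fin 2) (Fin 2) E) γ (latticeTreeIso σ ϖ (!![0, 1; 1, 0] : Matrix (Fin 2) (Fin 2) E) γ w) = latticeTreeIso σ ϖ (!![0, 1; 1, 0] : Matrix (Fin 2) (Fin 2) E) γ w :=
        (hY_cases _ hw).elim (hYAfix _) (hYBfix _)
      have hww : latticeTreeIso σ ϖ (!![0, 1; 1, 0] : Matrix (Fin 2) (Fin 2) E) γ w = w := (latticeTreePerm σ ϖ (!![0, 1; 1, 0] : Matrix (Fin 2) (Fin 2) E) γ).injective hfw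
      rwa [hww] at hw
    · intro hw
      have hfw : latticeTreePerm σ ϖ (!![0, 1; 1, 0] : Matrix (Fin 2) (Fin 2) E) γ w = w := (hY_cases _ hw).elim (hYAfix _) (hYBfix _)
      change latticeTreePerm σ ϖ (!![0, 1; 1, 0] : Matrix (Fin 2) (Fin 2) E) γ w ∈ ({v : {M : Submodule 𝒪[E] (Fin 2 → E) // IsSpecialLattice σ ϖ (!![0, 1; 1, 0] : Matrix (Fin 2) (Fin 2) E) M} | ∃ a b : ℤ, (a + b = 0 ∨ a + b = 1) ∧ v.1 = latt (Matrix.diagonal ![ϖ ^ a, ϖ ^ b])})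
      rwa [hfw]
  have hpγ : ∀ v : {M : Submodule 𝒪[E] (Fin 2 → E) // IsSpecialLattice σ ϖ (!![0, 1; 1, 0] : Matrix (Fin 2) (Fin 2) E) M}, v ∉ ({v : {M : Submodule 𝒪[E] (Fin 2 → E) // IsSpecialLattice σ ϖ (!![0, 1; 1, 0] : Matrix (Fin 2) (Fin 2) E) M} | ∃ a b : ℤ, (a + b = 0 ∨ a + b = 1) ∧ v.1 = latt (Matrix.diagonal ![ϖ ^ a, ϖ ^ b])}) → latticeTreePerm σ ϖ (!![0, 1; 1, 0] : Matrix (Fin 2) (Fin 2) E) γ v = v → latticeTreePerm σ ϖ (!![0, 1; 1, 0] : Matrix (Fin 2) (Fin 2) E) γ (p v) = p v := by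
    intro v hv hfv
    have h2 := ((hequiv (latticeTreeIso σ ϖ (!![0, 1; 1, 0] : Matrix (Fin 2) (Fin 2) E) γ) hγY) v).2 hv
    change p (latticeTreePerm σ ϖ (!![0, 1; 1, 0] : Matrix (Fin 2) (Fin 2) E) γ v) = latticeTreePerm σ ϖ (!![0, 1; 1, 0] : Matrix (Fin 2) (Fin 2) E) γ (p v) at h2
    rw [hfv] at h2
    exact h2.symm
  -- colour of the parent
  have hpar_col : ∀ v : {M : Submodule 𝒪[E] (Fin 2 → E) // IsSpecialLattice σ ϖ (!![0, 1; 1, 0] : Matrix (Fin 2) (Fin 2) E) M}, v ∉ ({v : {M : Submodule 𝒪[E] (Fin 2 → E) // IsSpecialLattice σ ϖ (!![0, 1; 1, 0] : Matrix (Fin 2) (Fin 2) E) M} | ∃ a b : ℤ, (a + b = 0 ∨ a + b = 1) ∧ v.1 = latt (Matrix.diagonal ![ϖ ^ a, ϖ ^ b])}) → (IsSelfDualLattice σ (!![0, 1; 1, 0] : Matrix (Fin 2) (Fin 2) E) v.1 → IsModularLattice σ ϖ (!![0, 1; 1, 0] : Matrix (Fin 2) (Fin 2) E) (p v).1) ∧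
      (IsModularLattice σ ϖ (!![0, 1; 1, 0] : Matrix (Fin 2) (Fin 2) E) v.1 → IsSelfDualLattice σ (!![0, 1; 1, 0] : Matrix (Fin 2) (Fin 2) E) (p v).1) := by
    intro v hv
    have hadj := (hpar v hv).1
    rcases (latticeTree_adj_iff σ ϖ _ v (p v)).1 hadj with ⟨-, ⟨h1, h2, -, -⟩ | ⟨h1, h2, -, -⟩⟩
    · exact ⟨fun _ => h2, fun hm => (hdisj _ h1 hm).elim⟩
    · exact ⟨fun hs => (hdisj _ hs h2).elim, fun _ => h1⟩
  -- (C) the tube count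
  have htube := natCard_quotient_tube (Φ := Subgroup.zpowers (latticeTreePerm σ ϖ (!![0, 1; 1, 0] : Matrix (Fin 2) (Fin 2) E) t)) (fun b a => (latticeTree σ ϖ (!![0, 1; 1, 0] : Matrix (Fin 2) (Fin 2) E)).Adj b a) (fun φ b a => latticeTree_adj_smul_iff σ ϖ t φ b a)
    ({v : {M : Submodule 𝒪[E] (Fin 2 → E) // IsSpecialLattice σ ϖ (!![0, 1; 1, 0] : Matrix (Fin 2) (Fin 2) E) M} | latticeTreeIso σ ϖ (!![0, 1; 1, 0] : Matrix (Fin 2) (Fin 2) E) γ v = v ∧ IsSelfDualLattice σ (!![0, 1; 1, 0] : Matrix (Fin 2) (Fin 2) E) v.1}) ({v : {M : Submodule 𝒪[E] (Fin 2 → E) // IsSpecialLattice σ ϖ (!![0, 1; 1, 0] : Matrix (Fin 2) (Fin 2) E) M} | ∃ a b : ℤ, a + b = 0 ∧ v.1 = latt (Matrix.diagonal ![ϖ ^ a, ϖ ^ b])}) ({v : {M : Submodule 𝒪[E] (Fin 2 → E) // IsSpecialLattice σ ϖ (!![0, 1; 1, 0] : Matrix (Fin 2) (Fin 2) E) M}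 | latticeTreeIso σ ϖ (!![0, 1; 1, 0] : Matrix (Fin 2) (Fin 2) E) γ v = v ∧ IsModularLattice σ ϖ (!![0, 1; 1, 0] : Matrix (Fin 2) (Fin 2) E) v.1}) ({v : {M : Submodule 𝒪[E] (Fin 2 → E) // IsSpecialLattice σ ϖ (!![0, 1; 1, 0] : Matrix (Fin 2) (Fin 2) E) M} | ∃ a b : ℤ, a + b = 1 ∧ v.1 = latt (Matrix.diagonal ![ϖ ^ a, ϖ ^ b])}) hYAFA hYBFB hFAi hFBi hYAi hYBi h h p p
    (fun φ a ha haY => hpφ φ a fun haY' => haY (hY_A a haY' ha.2))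
    (fun φ b hb hbY => hpφ φ b fun hbY' => hbY (hY_B b hbY' hb.2))
    (fun a ha haY => by
      have haY' : a ∉ ({v : {M : Submodule 𝒪[E] (Fin 2 → E) // IsSpecialLattice σ ϖ (!![0, 1; 1, 0] : Matrix (Fin 2) (Fin 2) E) M} | ∃ a b : ℤ, (a + b = 0 ∨ a + b = 1) ∧ v.1 = latt (Matrix.diagonal ![ϖ ^ a, ϖ ^ b])}) := fun h => haY (hY_A a h ha.2)
      exact ⟨(hpar a haY').1.symm, ⟨hpγ a haY' ha.1, (hpar_col a haY').1 ha.2⟩, (hpar a haY').2⟩)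
    (fun b hb hbY => by
      have hbY' : b ∉ ({v : {M : Submodule 𝒪[E] (Fin 2 → E) // IsSpecialLattice σ ϖ (!![0, 1; 1, 0] : Matrix (Fin 2) (Fin 2) E) M} | ∃ a b : ℤ, (a + b = 0 ∨ a + b = 1) ∧ v.1 = latt (Matrix.diagonal ![ϖ ^ a, ϖ ^ b])}) := fun h => hbY (hY_B b h hb.2)
      exact ⟨(hpar b hbY').1, ⟨hpγ b hbY' hb.1, (hpar_col b hbY').2 hb.2⟩, (hpar b hbY').2⟩)
    (fun b a hadj hb ha hnot => by
      have hnot' : ¬ (b ∈ ({v : {M : Submodule 𝒪[E] (Fin 2 → E) // IsSpecialLattice σ ϖ (!![0, 1; 1, 0] : Matrix (Fin 2) (Fin 2) E) M} | ∃ a b : ℤ, (a + b = 0 ∨ a + b = 1) ∧ v.1 = latt (Matrix.diagonal ![ϖ ^ a, ϖ ^ b])}) ∧ a ∈ ({v : {M : Submodule 𝒪[E] (Fin 2 → E) // IsSpecialLattice σ ϖ (!![0, 1; 1, 0] : Matrix (Fin 2) (Fin 2) E) M} | ∃ a b : ℤ, (a + b = 0 ∨ a + b = 1) ∧ v.1 =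 latt (Matrix.diagonal ![ϖ ^ a, ϖ ^ b])})) := fun ⟨hbY, haY⟩ => hnot ⟨hY_B b hbY hb.2, hY_A a haY ha.2⟩
      rcases hedgeY b a hadj hnot' with ⟨hbY, hpb⟩ | ⟨haY, hpa⟩
      · exact Or.inr ⟨fun h => hbY (hYBY b h), hpb⟩
      · exact Or.inl ⟨fun h => haY (hYAY a h), hpa⟩)
    hfinA hfinB hfinF
  -- (D) the axis counts
  have hv₀ : IsSpecialLattice σ ϖ (!![0, 1; 1, 0] : Matrix (Fin 2) (Fin 2) E) (latt (Matrix.diagonal ![ϖ ^ (0 : ℤ), ϖ ^ (0 : ℤ)])) :=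
    Or.inl (isSelfDualLattice_latt_diagonal_zpow σ hσv hϖ (by norm_num))
  have hw₁ : IsSpecialLattice σ ϖ (!![0, 1; 1, 0] : Matrix (Fin 2) (Fin 2) E) (latt (Matrix.diagonal ![ϖ ^ (0 : ℤ), ϖ ^ ((0 : ℤ) + 1)])) :=
    Or.inr (isModularLattice_latt_diagonal_zpow σ hσv hϖ (by norm_num))
  have hw₂ : IsSpecialLattice σ ϖ (!![0, 1; 1, 0] : Matrix (Fin 2) (Fin 2) E) (latt (Matrix.diagonal ![ϖ ^ ((0 : ℤ) + 1), ϖ ^ (0 : ℤ)])) :=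
    Or.inr (isModularLattice_latt_diagonal_zpow σ hσv hϖ (by norm_num))
  have hyA := (natCard_quotient_orbitRel_comap_eq_one (Φ := Subgroup.zpowers (latticeTreePerm σ ϖ (!![0, 1; 1, 0] : Matrix (Fin 2) (Fin 2) E) t)) ({v : {M : Submodule 𝒪[E] (Fin 2 → E) // IsSpecialLattice σ ϖ (!![0, 1; 1, 0] : Matrix (Fin 2) (Fin 2) E) M} | ∃ a b : ℤ, a + b = 0 ∧ v.1 = latt (Matrix.diagonal ![ϖ ^ a, ϖ ^ b])}) ⟨⟨_, hv₀⟩, 0, 0, by norm_num, rfl⟩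
    fun s s' => exists_smul_eq_of_mem_apartment σ hσv hϖ ht 0 s s' s.2 s'.2).2
  have hyB := (natCard_quotient_orbitRel_comap_eq_one (Φ := Subgroup.zpowers (latticeTreePerm σ ϖ (!![0, 1; 1, 0] : Matrix (Fin 2) (Fin 2) E) t)) ({v : {M : Submodule 𝒪[E] (Fin 2 → E) // IsSpecialLattice σ ϖ (!![0, 1; 1, 0] : Matrix (Fin 2) (Fin 2) E) M} | ∃ a b : ℤ, a + b = 1 ∧ v.1 = latt (Matrix.diagonal ![ϖ ^ a, ϖ ^ b])}) ⟨⟨_, hw₁⟩, 0, 0 + 1, by norm_num, rfl⟩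
    fun s s' => exists_smul_eq_of_mem_apartment σ hσv hϖ ht 1 s s' s.2 s'.2).2
  -- the two families of apartment flags
  have hflags : {q : {M : Submodule 𝒪[E] (Fin 2 → E) // IsSpecialLattice σ ϖ (!![0, 1; 1, 0] : Matrix (Fin 2) (Fin 2) E) M} × {M : Submodule 𝒪[E] (Fin 2 → E) // IsSpecialLattice σ ϖ (!![0, 1; 1, 0] : Matrix (Fin 2) (Fin 2) E) M} | (latticeTree σ ϖ (!![0, 1; 1, 0] : Matrix (Fin 2) (Fin 2) E)).Adj q.1 q.2 ∧ q.1 ∈ ({v : {M : Submodule 𝒪[E] (Fin 2 → E) // IsSpecialLattice σ ϖ (!![0, 1; 1, 0] : Matrix (Fin 2) (Fin 2) E) M} | ∃ a b : ℤ, a + b = 1 ∧ v.1 = latt (Matrix.diagonal ![ϖ ^ a, ϖ ^ b])}) ∧ q.2 ∈ ({v : {M : Submodule 𝒪[E] (Fin 2 → E) // IsSpecialLattice σ ϖ (!![0, 1; 1, 0] : Matrix (Fin 2) (Fin 2) E) M} | ∃ a b : ℤ, a + b = 0 ∧ v.1 = latt (Matrix.diagonal ![ϖ ^ a, ϖ ^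 b])})} = ({q : {M : Submodule 𝒪[E] (Fin 2 → E) // IsSpecialLattice σ ϖ (!![0, 1; 1, 0] : Matrix (Fin 2) (Fin 2) E) M} × {M : Submodule 𝒪[E] (Fin 2 → E) // IsSpecialLattice σ ϖ (!![0, 1; 1, 0] : Matrix (Fin 2) (Fin 2) E) M} | ∃ a b : ℤ, a + b = 0 ∧ q.2.1 = latt (Matrix.diagonal ![ϖ ^ a, ϖ ^ b]) ∧ q.1.1 = latt (Matrix.diagonal ![ϖ ^ a, ϖ ^ (b + 1)])}) ∪ ({q : {M : Submodule 𝒪[E] (Fin 2 → E) // IsSpecialLattice σ ϖ (!![0, 1; 1, 0] : Matrix (Fin 2) (Fin 2) E) M} × {M : Submodule 𝒪[E] (Fin 2 → E) // IsSpecialLattice σ ϖ (!![0, 1; 1, 0] : Matrix (Fin 2) (Fin 2) E) M} | ∃ a b : ℤ, a + b = 0 ∧ q.2.1 = latt (Matrix.diagonal ![ϖ ^ a, ϖ ^ b]) ∧ q.1.1 = latt (Matrix.diagonal ![ϖ ^ (a + 1), ϖ ^ b])}) := by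
    ext q
    constructor
    · rintro ⟨hadj, ⟨a', b', hab', hq1⟩, ⟨a, b, hab, hq2⟩⟩
      rcases eq_or_eq_of_latticeTree_adj_apartment σ hσv hϖ hab hab' q.2 q.1 hq2 hq1 (Or.inr hadj) with ⟨h1, h2⟩ | ⟨h1, h2⟩
      · rw [h1, h2] at hq1
        exact Or.inl ⟨a, b, hab, hq2, hq1⟩
      · rw [h1, h2] at hq1
        exact Or.inr ⟨a, b, hab, hq2, hq1⟩
    · rintro (⟨a, b, hab, hq2, hq1⟩ | ⟨a, b, hab, hq2, hq1⟩)
      · exact ⟨(latticeTree_adj_apartment σ hσv hϖ hab (Or.inl ⟨rfl, rfl⟩) q.2 q.1 hq2 hq1).symm, ⟨a, b + 1, by omega, hq1⟩, ⟨a, b, hab, hq2⟩⟩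
      · exact ⟨(latticeTree_adj_apartment σ hσv hϖ hab (Or.inr ⟨rfl, rfl⟩) q.2 q.1 hq2 hq1).symm, ⟨a + 1, b, by omega, hq1⟩, ⟨a, b, hab, hq2⟩⟩
  have hS_disj : Disjoint ({q : {M : Submodule 𝒪[E] (Fin 2 → E) // IsSpecialLattice σ ϖ (!![0, 1; 1, 0] : Matrix (Fin 2) (Fin 2) E) M} × {M : Submodule 𝒪[E] (Fin 2 → E) // IsSpecialLattice σ ϖ (!![0, 1; 1, 0] : Matrix (Fin 2) (Fin 2) E) M} | ∃ a b : ℤ, a + b = 0 ∧ q.2.1 = latt (Matrix.diagonal ![ϖ ^ a, ϖ ^ b]) ∧ q.1.1 = latt (Matrix.diagonal ![ϖ ^ a, ϖ ^ (b + 1)])}) ({q : {M : Submodule 𝒪[E] (Fin 2 → E) // IsSpecialLattice σ ϖ (!![0, 1; 1, 0] : Matrix (Fin 2) (Fin 2) E) M} × {M : Submodule 𝒪[E] (Fin 2 → E) // IsSpecialLattice σ ϖ (!![0, 1; 1, 0] : Matrix (Fin 2) (Fin 2) E) M} | ∃ a b : ℤ, a + b = 0 ∧ q.2.1 = latt (Matrix.diagonal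 ![ϖ ^ a, ϖ ^ b]) ∧ q.1.1 = latt (Matrix.diagonal ![ϖ ^ (a + 1), ϖ ^ b])}) := by
    rw [Set.disjoint_left]
    rintro q ⟨a, b, hab, hq2, hq1⟩ ⟨a', b', hab', hq2', hq1'⟩
    have h1 := (latt_diagonal_zpow_eq_iff hϖ a b a' b').1 (hq2.symm.trans hq2')
    have h2 := (latt_diagonal_zpow_eq_iff hϖ a (b + 1) (a' + 1) b').1 (hq1.symm.trans hq1')
    omega
  -- the action on pairs: components
  have hsmul_pair : ∀ (φ : Subgroup.zpowers (latticeTreePerm σ ϖ (!![0, 1; 1, 0] : Matrix (Fin 2) (Fin 2) E) t)) (q : {M : Submodule 𝒪[E] (Fin 2 → E) // IsSpecialLattice σ ϖ (!![0, 1; 1, 0] : Matrix (Fin 2) (Fin 2) E) M} × {M : Submodule 𝒪[E] (Fin 2 → E) // IsSpecialLattice σ ϖ (!![0, 1; 1, 0] : Matrix (Fin 2) (Fin 2) E) M}), φ • q = (φ • q.1, φ • q.2) := fun φ q => rfl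
  have hzpow_pair : ∀ (n : ℤ) (q : {M : Submodule 𝒪[E] (Fin 2 → E) // IsSpecialLattice σ ϖ (!![0, 1; 1, 0] : Matrix (Fin 2) (Fin 2) E) M} × {M : Submodule 𝒪[E] (Fin 2 → E) // IsSpecialLattice σ ϖ (!![0, 1; 1, 0] : Matrix (Fin 2) (Fin 2) E) M}) (a b a₁ b₁ : ℤ), q.2.1 = latt (Matrix.diagonal ![ϖ ^ a, ϖ ^ b]) →
      q.1.1 = latt (Matrix.diagonal ![ϖ ^ a₁, ϖ ^ b₁]) →
      (((⟨(latticeTreePerm σ ϖ (!![0, 1; 1, 0] : Matrix (Fin 2) (Fin 2) E) t) ^ n, n, rfl⟩ : Subgroup.zpowers (latticeTreePerm σ ϖ (!![0, 1; 1, 0] : Matrix (Fin 2) (Fin 2) E) t)) • q).2.1 = latt (Matrix.diagonal ![ϖ ^ (a + n), ϖ ^ (b - n)]) ∧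
        ((⟨(latticeTreePerm σ ϖ (!![0, 1; 1, 0] : Matrix (Fin 2) (Fin 2) E) t) ^ n, n, rfl⟩ : Subgroup.zpowers (latticeTreePerm σ ϖ (!![0, 1; 1, 0] : Matrix (Fin 2) (Fin 2) E) t)) • q).1.1 = latt (Matrix.diagonal ![ϖ ^ (a₁ + n), ϖ ^ (b₁ - n)])) := by
    intro n q a b a₁ b₁ hq2 hq1
    rw [hsmul_pair]
    exact ⟨coe_latticeTreePerm_zpow_apply_of_eq_latt_diagonal σ hσv hϖ ht n q.2 a b hq2,
      coe_latticeTreePerm_zpow_apply_of_eq_latt_diagonal σ hσv hϖ ht n q.1 a₁ b₁ hq1⟩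
  have hS₁i : ∀ (φ : Subgroup.zpowers (latticeTreePerm σ ϖ (!![0, 1; 1, 0] : Matrix (Fin 2) (Fin 2) E) t)) (q : {M : Submodule 𝒪[E] (Fin 2 → E) // IsSpecialLattice σ ϖ (!![0, 1; 1, 0] : Matrix (Fin 2) (Fin 2) E) M} × {M : Submodule 𝒪[E] (Fin 2 → E) // IsSpecialLattice σ ϖ (!![0, 1; 1, 0] : Matrix (Fin 2) (Fin 2) E) M}), q ∈ ({q : {M : Submodule 𝒪[E] (Fin 2 → E) // IsSpecialLattice σ ϖ (!![0, 1; 1, 0] : Matrix (Fin 2) (Fin 2) E) M} × {M : Submodule 𝒪[E] (Fin 2 → E) // IsSpecialLattice σ ϖ (!![0, 1; 1, 0] : Matrix (Fin 2) (Fin 2) E) M} | ∃ a b : ℤ, a + b = 0 ∧ q.2.1 = latt (Matrix.diagonal ![ϖ ^ a, ϖ ^ b]) ∧ q.1.1 = latt (Matrix.diagonal ![ϖ ^ a, ϖ ^ (b + 1)])}) → φ • q ∈ ({q : {M : Submodule 𝒪[E] (Fin 2 → E) // IsSpecialLattice σ ϖ (!![0, 1; 1, 0] : Matrix (Fin 2)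 (Fin 2) E) M} × {M : Submodule 𝒪[E] (Fin 2 → E) // IsSpecialLattice σ ϖ (!![0, 1; 1, 0] : Matrix (Fin 2) (Fin 2) E) M} | ∃ a b : ℤ, a + b = 0 ∧ q.2.1 = latt (Matrix.diagonal ![ϖ ^ a, ϖ ^ b]) ∧ q.1.1 = latt (Matrix.diagonal ![ϖ ^ a, ϖ ^ (b + 1)])}) := by
    rintro φ q ⟨a, b, hab, hq2, hq1⟩
    obtain ⟨n, hn⟩ := Subgroup.mem_zpowers_iff.1 φ.2
    have hφ : φ = ⟨(latticeTreePerm σ ϖ (!![0, 1; 1, 0] : Matrix (Fin 2) (Fin 2) E) t) ^ n, n, rfl⟩ := Subtype.ext hn.symm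
    subst hφ
    obtain ⟨h2, h1⟩ := hzpow_pair n q a b a (b + 1) hq2 hq1
    exact ⟨a + n, b - n, by omega, h2, by rw [h1, show b + 1 - n = b - n + 1 by ring]⟩
  have htrans : ∀ (S : Set ({M : Submodule 𝒪[E] (Fin 2 → E) // IsSpecialLattice σ ϖ (!![0, 1; 1, 0] : Matrix (Fin 2) (Fin 2) E) M} × {M : Submodule 𝒪[E] (Fin 2 → E) // IsSpecialLattice σ ϖ (!![0, 1; 1, 0] : Matrix (Fin 2) (Fin 2) E) M})) (da db : ℤ),
      (∀ q ∈ S, ∃ a b : ℤ, a + b = 0 ∧ q.2.1 = latt (Matrix.diagonal ![ϖ ^ a, ϖ ^ b]) ∧ q.1.1 = latt (Matrix.diagonal ![ϖ ^ (a + da), ϖ ^ (b + db)])) →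
      ∀ s s' : S, ∃ φ : Subgroup.zpowers (latticeTreePerm σ ϖ (!![0, 1; 1, 0] : Matrix (Fin 2) (Fin 2) E) t), φ • (s' : {M : Submodule 𝒪[E] (Fin 2 → E) // IsSpecialLattice σ ϖ (!![0, 1; 1, 0] : Matrix (Fin 2) (Fin 2) E) M} × {M : Submodule 𝒪[E] (Fin 2 → E) // IsSpecialLattice σ ϖ (!![0, 1; 1, 0] : Matrix (Fin 2) (Fin 2) E) M}) = s := by
    intro S da db hS s s'
    obtain ⟨a, b, hab, hs2, hs1⟩ := hS s s.2
    obtain ⟨a', b', hab', hs2', hs1'⟩ := hS s' s'.2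
    refine ⟨⟨(latticeTreePerm σ ϖ (!![0, 1; 1, 0] : Matrix (Fin 2) (Fin 2) E) t) ^ (a - a'), a - a', rfl⟩, ?_⟩
    obtain ⟨h2, h1⟩ := hzpow_pair (a - a') s' a' b' (a' + da) (b' + db) hs2' hs1'
    refine Prod.ext (Subtype.ext ?_) (Subtype.ext ?_)
    · rw [h1, hs1, show a' + da + (a - a') = a + da by ring, show b' + db - (a - a') = b + db by omega]
    · rw [h2, hs2, show a' + (a - a') = a by ring, show b' - (a - a') = b by omega]
  have htrans₁ := htrans ({q : {M : Submodule 𝒪[E] (Fin 2 → E) // IsSpecialLattice σ ϖ (!![0, 1; 1, 0] : Matrix (Fin 2) (Fin 2) E) M} × {M : Submodule 𝒪[E] (Fin 2 → E) // IsSpecialLattice σ ϖ (!![0, 1; 1, 0] : Matrix (Fin 2) (Fin 2) E) M} | ∃ a b : ℤ, a + b = 0 ∧ q.2.1 = latt (Matrix.diagonal ![ϖ ^ a, ϖ ^ b]) ∧ q.1.1 = latt (Matrix.diagonal ![ϖ ^ a, ϖ ^ (b + 1)])}) 0 1 (fun q ⟨a, b, hab, hq2, hq1⟩ => ⟨a,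 b, hab, hq2, by rw [hq1, add_zero]⟩)
  have htrans₂ := htrans ({q : {M : Submodule 𝒪[E] (Fin 2 → E) // IsSpecialLattice σ ϖ (!![0, 1; 1, 0] : Matrix (Fin 2) (Fin 2) E) M} × {M : Submodule 𝒪[E] (Fin 2 → E) // IsSpecialLattice σ ϖ (!![0, 1; 1, 0] : Matrix (Fin 2) (Fin 2) E) M} | ∃ a b : ℤ, a + b = 0 ∧ q.2.1 = latt (Matrix.diagonal ![ϖ ^ a, ϖ ^ b]) ∧ q.1.1 = latt (Matrix.diagonal ![ϖ ^ (a + 1), ϖ ^ b])}) 1 0 (fun q ⟨a, b, hab, hq2, hq1⟩ => ⟨a, b, hab, hq2, by rw [hq1, add_zero]⟩)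
  have hne₁ : ({q : {M : Submodule 𝒪[E] (Fin 2 → E) // IsSpecialLattice σ ϖ (!![0, 1; 1, 0] : Matrix (Fin 2) (Fin 2) E) M} × {M : Submodule 𝒪[E] (Fin 2 → E) // IsSpecialLattice σ ϖ (!![0, 1; 1, 0] : Matrix (Fin 2) (Fin 2) E) M} | ∃ a b : ℤ, a + b = 0 ∧ q.2.1 = latt (Matrix.diagonal ![ϖ ^ a, ϖ ^ b]) ∧ q.1.1 = latt (Matrix.diagonal ![ϖ ^ a, ϖ ^ (b + 1)])}).Nonempty := ⟨(⟨_, hw₁⟩, ⟨_, hv₀⟩), 0, 0, by norm_num, rfl, rfl⟩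
  have hne₂ : ({q : {M : Submodule 𝒪[E] (Fin 2 → E) // IsSpecialLattice σ ϖ (!![0, 1; 1, 0] : Matrix (Fin 2) (Fin 2) E) M} × {M : Submodule 𝒪[E] (Fin 2 → E) // IsSpecialLattice σ ϖ (!![0, 1; 1, 0] : Matrix (Fin 2) (Fin 2) E) M} | ∃ a b : ℤ, a + b = 0 ∧ q.2.1 = latt (Matrix.diagonal ![ϖ ^ a, ϖ ^ b]) ∧ q.1.1 = latt (Matrix.diagonal ![ϖ ^ (a + 1), ϖ ^ b])}).Nonempty := ⟨(⟨_, hw₂⟩, ⟨_, hv₀⟩), 0, 0, by norm_num, rfl, rfl⟩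
  have hfY := (natCard_quotient_orbitRel_comap_eq_two (Φ := Subgroup.zpowers (latticeTreePerm σ ϖ (!![0, 1; 1, 0] : Matrix (Fin 2) (Fin 2) E) t)) ({q : {M : Submodule 𝒪[E] (Fin 2 → E) // IsSpecialLattice σ ϖ (!![0, 1; 1, 0] : Matrix (Fin 2) (Fin 2) E) M} × {M : Submodule 𝒪[E] (Fin 2 → E) // IsSpecialLattice σ ϖ (!![0, 1; 1, 0] : Matrix (Fin 2) (Fin 2) E) M} | ∃ a b : ℤ, a + b = 0 ∧ q.2.1 = latt (Matrix.diagonal ![ϖ ^ a, ϖ ^ b]) ∧ q.1.1 = latt (Matrix.diagonal ![ϖ ^ a, ϖ ^ (b + 1)])}) ({q : {M : Submodule 𝒪[E] (Fin 2 → E) // IsSpecialLattice σ ϖ (!![0, 1; 1, 0] : Matrix (Fin 2) (Fin 2) E) M} × {M : Submodule 𝒪[E] (Fin 2 → E) // IsSpecialLattice σ ϖ (!![0, 1; 1, 0] : Matrix (Fin 2) (Fin 2) E) M} | ∃ a b : ℤ, a + b = 0 ∧ q.2.1 = latt (Matrix.diagonal ![ϖ ^ a, ϖ ^ b]) ∧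 q.1.1 = latt (Matrix.diagonal ![ϖ ^ (a + 1), ϖ ^ b])}) hS_disj hS₁i hne₁ hne₂ htrans₁ htrans₂).2
  rw [← hflags] at hfY
  exact natCard_quotient_tube_axis_cancel htube hyA hyB hfY

include hσv hϖ in
/-- **The same period identity with the flags written as in ★ (S6) `exists_equiv_fixedBy_inf_fixed_flags_apply`** (ordered `(self-dual, ϖ-modular)` pairs with
`ϖ p.1 ≤ p.2 ≤ p.1`, both `γ`-fixed): the swap `(b, a) ↦ (a, b)` is a `Φ_t`-equivariant bijection onto the adjacency flags (★ `latticeTree_adj_iff`), ★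
`natCard_quotient_orbitRel_comap_eq_of_bijective`. [cite: Kottwitz1988, §2 Theorem 2] [cite: Serre1980Trees, I.6.4; II.1.1] -/
theorem natCard_quotient_fixed_add_eq_natCard_quotient_fixedFlags' [IsDiscreteValuationRing 𝒪[E]]
    {t γ : unitaryGroupOfForm σ (!![0, 1; 1, 0] : Matrix (Fin 2) (Fin 2) E)} (ht : ((t : GL (Fin 2) E) : Matrix (Fin 2) (Fin 2) E) = Matrix.diagonal ![ϖ, (σ ϖ)⁻¹])
    {e : Fin 2 → E} (hγ : ((γ : GL (Fin 2) E) : Matrix (Fin 2) (Fin 2) E) = Matrix.diagonal e) (he : ∀ i, valuation E (e i) = 1)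
    (hfinA : Finite (Quotient ((MulAction.orbitRel (Subgroup.zpowers (latticeTreePerm σ ϖ (!![0, 1; 1, 0] : Matrix (Fin 2) (Fin 2) E) t)) {M : Submodule 𝒪[E] (Fin 2 → E) // IsSpecialLattice σ ϖ (!![0, 1; 1, 0] : Matrix (Fin 2) (Fin 2) E) M}).comap (Subtype.val : {v : {M : Submodule 𝒪[E] (Fin 2 → E) // IsSpecialLattice σ ϖ (!![0, 1; 1, 0] : Matrix (Fin 2) (Fin 2) E) M} | latticeTreeIso σ ϖ (!![0, 1; 1, 0] : Matrix (Fin 2) (Fin 2) E) γ v = v ∧ IsSelfDualLattice σ (!![0, 1; 1, 0] : Matrix (Fin 2) (Fin 2) E) v.1} → {M : Submodule 𝒪[E] (Fin 2 → E) // IsSpecialLattice σ ϖ (!![0, 1; 1, 0] : Matrix (Fin 2) (Fin 2) E) M}))))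
    (hfinB : Finite (Quotient ((MulAction.orbitRel (Subgroup.zpowers (latticeTreePerm σ ϖ (!![0, 1; 1, 0] : Matrix (Fin 2) (Fin 2) E) t)) {M : Submodule 𝒪[E] (Fin 2 → E) // IsSpecialLattice σ ϖ (!![0, 1; 1, 0] : Matrix (Fin 2) (Fin 2) E) M}).comap (Subtype.val : {v : {M : Submodule 𝒪[E] (Fin 2 → E) // IsSpecialLattice σ ϖ (!![0, 1; 1, 0] : Matrix (Fin 2) (Fin 2) E) M} | latticeTreeIso σ ϖ (!![0, 1; 1, 0] : Matrix (Fin 2) (Fin 2) E) γ v = v ∧ IsModularLattice σ ϖ (!![0, 1; 1, 0] : Matrix (Fin 2) (Fin 2) E) v.1} → {M : Submodule 𝒪[E] (Fin 2 → E) // IsSpecialLattice σ ϖ (!![0, 1; 1, 0] : Matrix (Fin 2) (Fin 2) E) M}))))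
    (hfinF : Finite (Quotient ((MulAction.orbitRel (Subgroup.zpowers (latticeTreePerm σ ϖ (!![0, 1; 1, 0] : Matrix (Fin 2) (Fin 2) E) t)) ({M : Submodule 𝒪[E] (Fin 2 → E) // IsSpecialLattice σ ϖ (!![0, 1; 1, 0] : Matrix (Fin 2) (Fin 2) E) M} × {M : Submodule 𝒪[E] (Fin 2 → E) // IsSpecialLattice σ ϖ (!![0, 1; 1, 0] : Matrix (Fin 2) (Fin 2) E) M})).comap (Subtype.val : {p : {M : Submodule 𝒪[E] (Fin 2 → E) // IsSpecialLattice σ ϖ (!![0, 1; 1, 0] : Matrix (Fin 2) (Fin 2) E) M} × {M : Submodule 𝒪[E] (Fin 2 → E) // IsSpecialLattice σ ϖ (!![0, 1; 1, 0] : Matrix (Fin 2) (Fin 2) E) M} | IsSelfDualLattice σ (!![0, 1; 1, 0] : Matrix (Fin 2) (Fin 2) E) p.1.1 ∧ IsModularLattice σ ϖ (!![0, 1; 1, 0] : Matrix (Fin 2) (Fin 2) E) p.2.1 ∧ scaleLattice ϖ p.1.1 ≤ p.2.1 ∧ p.2.1 ≤ p.1.1 ∧ latticeTreeIso σ ϖ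 (!![0, 1; 1, 0] : Matrix (Fin 2) (Fin 2) E) γ p.1 = p.1 ∧ latticeTreeIso σ ϖ (!![0, 1; 1, 0] : Matrix (Fin 2) (Fin 2) E) γ p.2 = p.2} → {M : Submodule 𝒪[E] (Fin 2 → E) // IsSpecialLattice σ ϖ (!![0, 1; 1, 0] : Matrix (Fin 2) (Fin 2) E) M} × {M : Submodule 𝒪[E] (Fin 2 → E) // IsSpecialLattice σ ϖ (!![0, 1; 1, 0] : Matrix (Fin 2) (Fin 2) E) M})))) :
    Nat.card (Quotient ((MulAction.orbitRel (Subgroup.zpowers (latticeTreePerm σ ϖ (!![0, 1; 1, 0] : Matrix (Fin 2) (Fin 2) E) t)) {M : Submodule 𝒪[E] (Fin 2 → E) // IsSpecialLattice σ ϖ (!![0, 1; 1, 0] : Matrix (Fin 2) (Fin 2) E) M}).comap (Subtype.val : {v : {M : Submodule 𝒪[E] (Fin 2 → E) // IsSpecialLattice σ ϖ (!![0, 1; 1, 0] : Matrix (Fin 2) (Fin 2) E) M} | latticeTreeIso σ ϖ (!![0, 1; 1, 0] : Matrix (Fin 2) (Fin 2) E) γ v = v ∧ IsSelfDualLattice σ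 (!![0, 1; 1, 0] : Matrix (Fin 2) (Fin 2) E) v.1} → {M : Submodule 𝒪[E] (Fin 2 → E) // IsSpecialLattice σ ϖ (!![0, 1; 1, 0] : Matrix (Fin 2) (Fin 2) E) M}))) +
      Nat.card (Quotient ((MulAction.orbitRel (Subgroup.zpowers (latticeTreePerm σ ϖ (!![0, 1; 1, 0] : Matrix (Fin 2) (Fin 2) E) t)) {M : Submodule 𝒪[E] (Fin 2 → E) // IsSpecialLattice σ ϖ (!![0, 1; 1, 0] : Matrix (Fin 2) (Fin 2) E) M}).comap (Subtype.val : {v : {M : Submodule 𝒪[E] (Fin 2 → E) // IsSpecialLattice σ ϖ (!![0, 1; 1, 0] : Matrix (Fin 2) (Fin 2) E) M} | latticeTreeIso σ ϖ (!![0, 1; 1, 0] : Matrix (Fin 2) (Fin 2) E) γ v = v ∧ IsModularLattice σ ϖ (!![0, 1; 1, 0] : Matrix (Fin 2) (Fin 2) E) v.1} → {M : Submodule 𝒪[E] (Fin 2 → E) // IsSpecialLattice σ ϖ (!![0, 1; 1, 0] : Matrix (Fin 2) (Fin 2) E) M}))) =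
      Nat.card (Quotient ((MulAction.orbitRel (Subgroup.zpowers (latticeTreePerm σ ϖ (!![0, 1; 1, 0] : Matrix (Fin 2) (Fin 2) E) t)) ({M : Submodule 𝒪[E] (Fin 2 → E) // IsSpecialLattice σ ϖ (!![0, 1; 1, 0] : Matrix (Fin 2) (Fin 2) E) M} × {M : Submodule 𝒪[E] (Fin 2 → E) // IsSpecialLattice σ ϖ (!![0, 1; 1, 0] : Matrix (Fin 2) (Fin 2) E) M})).comap (Subtype.val : {p : {M : Submodule 𝒪[E] (Fin 2 → E) // IsSpecialLattice σ ϖ (!![0, 1; 1, 0] : Matrix (Fin 2) (Fin 2) E) M} × {M : Submodule 𝒪[E] (Fin 2 → E) // IsSpecialLattice σ ϖ (!![0, 1; 1, 0] : Matrix (Fin 2) (Fin 2) E) M} | IsSelfDualLattice σ (!![0, 1; 1, 0] : Matrix (Fin 2) (Fin 2) E) p.1.1 ∧ IsModularLattice σ ϖ (!![0, 1; 1, 0] : Matrix (Fin 2) (Fin 2) E) p.2.1 ∧ scaleLattice ϖ p.1.1 ≤ p.2.1 ∧ p.2.1 ≤ p.1.1 ∧ latticeTreeIso σ ϖ (!![0,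 1; 1, 0] : Matrix (Fin 2) (Fin 2) E) γ p.1 = p.1 ∧ latticeTreeIso σ ϖ (!![0, 1; 1, 0] : Matrix (Fin 2) (Fin 2) E) γ p.2 = p.2} → {M : Submodule 𝒪[E] (Fin 2 → E) // IsSpecialLattice σ ϖ (!![0, 1; 1, 0] : Matrix (Fin 2) (Fin 2) E) M} × {M : Submodule 𝒪[E] (Fin 2 → E) // IsSpecialLattice σ ϖ (!![0, 1; 1, 0] : Matrix (Fin 2) (Fin 2) E) M}))) := by
  classical
  have hdisj : ∀ M : Submodule 𝒪[E] (Fin 2 → E), IsSelfDualLattice σ (!![0, 1; 1, 0] : Matrix (Fin 2) (Fin 2) E) M → IsModularLattice σ ϖ (!![0, 1; 1, 0] : Matrix (Fin 2) (Fin 2) E) M → False :=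
    fun M h1 h2 => not_isModularLattice_of_isSelfDualLattice σ hσv hϖ _ h1 h2
  -- membership conversions between the two flag sets
  have hto : ∀ p : {M : Submodule 𝒪[E] (Fin 2 → E) // IsSpecialLattice σ ϖ (!![0, 1; 1, 0] : Matrix (Fin 2) (Fin 2) E) M} × {M : Submodule 𝒪[E] (Fin 2 → E) // IsSpecialLattice σ ϖ (!![0, 1; 1, 0] : Matrix (Fin 2) (Fin 2) E) M}, p ∈ {p : {M : Submodule 𝒪[E] (Fin 2 → E) // IsSpecialLattice σ ϖ (!![0, 1; 1, 0] : Matrix (Fin 2) (Fin 2) E) M} × {M : Submodule 𝒪[E] (Fin 2 → E) // IsSpecialLattice σ ϖ (!![0, 1; 1, 0] : Matrix (Fin 2) (Fin 2) E) M} | (latticeTree σ ϖ (!![0, 1; 1, 0] : Matrix (Fin 2) (Fin 2) E)).Adj p.1 p.2 ∧ p.1 ∈ {v : {M : Submodule 𝒪[E] (Fin 2 → E) // IsSpecialLattice σ ϖ (!![0, 1; 1, 0] : Matrix (Fin 2) (Fin 2) E) M} | latticeTreeIso σ ϖ (!![0, 1; 1, 0] : Matrix (Fin 2) (Fin 2)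 E) γ v = v ∧ IsModularLattice σ ϖ (!![0, 1; 1, 0] : Matrix (Fin 2) (Fin 2) E) v.1} ∧ p.2 ∈ {v : {M : Submodule 𝒪[E] (Fin 2 → E) // IsSpecialLattice σ ϖ (!![0, 1; 1, 0] : Matrix (Fin 2) (Fin 2) E) M} | latticeTreeIso σ ϖ (!![0, 1; 1, 0] : Matrix (Fin 2) (Fin 2) E) γ v = v ∧ IsSelfDualLattice σ (!![0, 1; 1, 0] : Matrix (Fin 2) (Fin 2) E) v.1}} → p.swap ∈ {p : {M : Submodule 𝒪[E] (Fin 2 → E) // IsSpecialLattice σ ϖ (!![0, 1; 1, 0] : Matrix (Fin 2) (Fin 2) E) M} × {M : Submodule 𝒪[E] (Fin 2 → E) // IsSpecialLattice σ ϖ (!![0, 1; 1, 0] : Matrix (Fin 2) (Fin 2) E) M} | IsSelfDualLattice σ (!![0, 1; 1, 0] : Matrix (Fin 2) (Fin 2) E) p.1.1 ∧ IsModularLattice σ ϖ (!![0, 1; 1, 0] : Matrix (Fin 2) (Fin 2) E) p.2.1 ∧ scaleLattice ϖ p.1.1 ≤ p.2.1 ∧ p.2.1 ≤ p.1.1 ∧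 latticeTreeIso σ ϖ (!![0, 1; 1, 0] : Matrix (Fin 2) (Fin 2) E) γ p.1 = p.1 ∧ latticeTreeIso σ ϖ (!![0, 1; 1, 0] : Matrix (Fin 2) (Fin 2) E) γ p.2 = p.2} := by
    rintro p ⟨hadj, ⟨hb, hbm⟩, ⟨ha, has⟩⟩
    rcases (latticeTree_adj_iff σ ϖ _ p.1 p.2).1 hadj with ⟨-, ⟨h1, -, -, -⟩ | ⟨h1, h2, h3, h4⟩⟩
    · exact (hdisj _ h1 hbm).elim
    · exact ⟨h1, h2, h3, h4, ha, hb⟩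
  have hfrom : ∀ q : {M : Submodule 𝒪[E] (Fin 2 → E) // IsSpecialLattice σ ϖ (!![0, 1; 1, 0] : Matrix (Fin 2) (Fin 2) E) M} × {M : Submodule 𝒪[E] (Fin 2 → E) // IsSpecialLattice σ ϖ (!![0, 1; 1, 0] : Matrix (Fin 2) (Fin 2) E) M}, q ∈ {p : {M : Submodule 𝒪[E] (Fin 2 → E) // IsSpecialLattice σ ϖ (!![0, 1; 1, 0] : Matrix (Fin 2) (Fin 2) E) M} × {M : Submodule 𝒪[E] (Fin 2 → E) // IsSpecialLattice σ ϖ (!![0, 1; 1, 0] : Matrix (Fin 2) (Fin 2) E) M} | IsSelfDualLattice σ (!![0, 1; 1, 0] : Matrix (Fin 2) (Fin 2) E) p.1.1 ∧ IsModularLattice σ ϖ (!![0, 1; 1, 0] : Matrix (Fin 2) (Fin 2) E) p.2.1 ∧ scaleLattice ϖ p.1.1 ≤ p.2.1 ∧ p.2.1 ≤ p.1.1 ∧ latticeTreeIso σ ϖ (!![0, 1; 1, 0] : Matrix (Fin 2) (Fin 2) E) γ p.1 = p.1 ∧ latticeTreeIso σ ϖ (!![0, 1; 1, 0] : Matrix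 (Fin 2) (Fin 2) E) γ p.2 = p.2} → q.swap ∈ {p : {M : Submodule 𝒪[E] (Fin 2 → E) // IsSpecialLattice σ ϖ (!![0, 1; 1, 0] : Matrix (Fin 2) (Fin 2) E) M} × {M : Submodule 𝒪[E] (Fin 2 → E) // IsSpecialLattice σ ϖ (!![0, 1; 1, 0] : Matrix (Fin 2) (Fin 2) E) M} | (latticeTree σ ϖ (!![0, 1; 1, 0] : Matrix (Fin 2) (Fin 2) E)).Adj p.1 p.2 ∧ p.1 ∈ {v : {M : Submodule 𝒪[E] (Fin 2 → E) // IsSpecialLattice σ ϖ (!![0, 1; 1, 0] : Matrix (Fin 2) (Fin 2) E) M} | latticeTreeIso σ ϖ (!![0, 1; 1, 0] : Matrix (Fin 2) (Fin 2) E) γ v = v ∧ IsModularLattice σ ϖ (!![0, 1; 1, 0] : Matrix (Fin 2) (Fin 2) E) v.1} ∧ p.2 ∈ {v : {M : Submodule 𝒪[E] (Fin 2 → E) // IsSpecialLattice σ ϖ (!![0, 1; 1, 0] : Matrix (Fin 2) (Fin 2) E) M} | latticeTreeIso σ ϖ (!![0, 1; 1, 0] : Matrix (Fin 2) (Fin 2)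 E) γ v = v ∧ IsSelfDualLattice σ (!![0, 1; 1, 0] : Matrix (Fin 2) (Fin 2) E) v.1}} := by
    rintro q ⟨h1, h2, h3, h4, h5, h6⟩
    refine ⟨(latticeTree_adj_iff σ ϖ _ q.2 q.1).2 ⟨fun h => hdisj _ (h ▸ h1 : IsSelfDualLattice σ (!![0, 1; 1, 0] : Matrix (Fin 2) (Fin 2) E) q.2.1) h2, Or.inr ⟨h1, h2, h3, h4⟩⟩, ⟨h6, h2⟩, ⟨h5, h1⟩⟩
  have hbij := natCard_quotient_orbitRel_comap_eq_of_bijective (Φ := Subgroup.zpowers (latticeTreePerm σ ϖ (!![0, 1; 1, 0] : Matrix (Fin 2) (Fin 2) E) t)) {p : {M : Submodule 𝒪[E] (Fin 2 → E) // IsSpecialLattice σ ϖ (!![0, 1; 1, 0] : Matrix (Fin 2) (Fin 2) E) M} × {M : Submodule 𝒪[E] (Fin 2 → E) // IsSpecialLattice σ ϖ (!![0, 1; 1, 0] : Matrix (Fin 2) (Fin 2) E) M} | (latticeTree σ ϖ (!![0, 1; 1, 0] : Matrix (Fin 2) (Fin 2) E)).Adj p.1 p.2 ∧ p.1 ∈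 {v : {M : Submodule 𝒪[E] (Fin 2 → E) // IsSpecialLattice σ ϖ (!![0, 1; 1, 0] : Matrix (Fin 2) (Fin 2) E) M} | latticeTreeIso σ ϖ (!![0, 1; 1, 0] : Matrix (Fin 2) (Fin 2) E) γ v = v ∧ IsModularLattice σ ϖ (!![0, 1; 1, 0] : Matrix (Fin 2) (Fin 2) E) v.1} ∧ p.2 ∈ {v : {M : Submodule 𝒪[E] (Fin 2 → E) // IsSpecialLattice σ ϖ (!![0, 1; 1, 0] : Matrix (Fin 2) (Fin 2) E) M} | latticeTreeIso σ ϖ (!![0, 1; 1, 0] : Matrix (Fin 2) (Fin 2) E) γ v = v ∧ IsSelfDualLattice σ (!![0, 1; 1, 0] : Matrix (Fin 2) (Fin 2) E) v.1}} {p : {M : Submodule 𝒪[E] (Fin 2 → E) // IsSpecialLattice σ ϖ (!![0, 1; 1, 0] : Matrix (Fin 2) (Fin 2) E) M} × {M : Submodule 𝒪[E] (Fin 2 → E) // IsSpecialLattice σ ϖ (!![0, 1; 1, 0] : Matrix (Fin 2) (Fin 2) E) M} | IsSelfDualLattice σ (!![0, 1; 1, 0] : Matrix (Fin 2) (Fin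 2) E) p.1.1 ∧ IsModularLattice σ ϖ (!![0, 1; 1, 0] : Matrix (Fin 2) (Fin 2) E) p.2.1 ∧ scaleLattice ϖ p.1.1 ≤ p.2.1 ∧ p.2.1 ≤ p.1.1 ∧ latticeTreeIso σ ϖ (!![0, 1; 1, 0] : Matrix (Fin 2) (Fin 2) E) γ p.1 = p.1 ∧ latticeTreeIso σ ϖ (!![0, 1; 1, 0] : Matrix (Fin 2) (Fin 2) E) γ p.2 = p.2}
    (fun p => ⟨p.1.swap, hto p.1 p.2⟩)
    ⟨fun p q h => Subtype.ext (Prod.swap_injective (congrArg Subtype.val h)), fun q => ⟨⟨q.1.swap, hfrom q.1 q.2⟩, Subtype.ext (Prod.swap_swap q.1)⟩⟩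
    (fun p q => by
      constructor
      · rintro ⟨φ, hφ⟩
        exact ⟨φ, by change φ • (q : {M : Submodule 𝒪[E] (Fin 2 → E) // IsSpecialLattice σ ϖ (!![0, 1; 1, 0] : Matrix (Fin 2) (Fin 2) E) M} × {M : Submodule 𝒪[E] (Fin 2 → E) // IsSpecialLattice σ ϖ (!![0, 1; 1, 0] : Matrix (Fin 2) (Fin 2) E) M}).swap = (p : {M : Submodule 𝒪[E] (Fin 2 → E) // IsSpecialLattice σ ϖ (!![0, 1; 1, 0] : Matrix (Fin 2) (Fin 2) E) M} × {M : Submodule 𝒪[E] (Fin 2 → E) // IsSpecialLattice σ ϖ (!![0, 1; 1, 0] : Matrix (Fin 2) (Fin 2) E) M}).swap; rw [← Prod.smul_swap, hφ]⟩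
      · rintro ⟨φ, hφ⟩
        refine ⟨φ, ?_⟩
        change φ • (q : {M : Submodule 𝒪[E] (Fin 2 → E) // IsSpecialLattice σ ϖ (!![0, 1; 1, 0] : Matrix (Fin 2) (Fin 2) E) M} × {M : Submodule 𝒪[E] (Fin 2 → E) // IsSpecialLattice σ ϖ (!![0, 1; 1, 0] : Matrix (Fin 2) (Fin 2) E) M}).swap = (p : {M : Submodule 𝒪[E] (Fin 2 → E) // IsSpecialLattice σ ϖ (!![0, 1; 1, 0] : Matrix (Fin 2) (Fin 2) E) M} × {M : Submodule 𝒪[E] (Fin 2 → E) // IsSpecialLattice σ ϖ (!![0, 1; 1, 0] : Matrix (Fin 2) (Fin 2) E) M}).swap at hφ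
        rw [← Prod.smul_swap] at hφ
        exact Prod.swap_injective hφ)
  rw [← hbij.1]
  exact natCard_quotient_fixed_add_eq_natCard_quotient_fixedFlags σ hσv hϖ ht hγ he hfinA hfinB (hbij.2.2 hfinF)

end Period

end Literature.NumberTheory.Automorphic.HermitianLatticeTree

end
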